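import Literature.LinearAlgebra.TensorNetworks.QTTLaplaceNeumannPeriodic

/-!
# QTT structure of the multi-dimensional Laplace operator, II: Neumann-type factors (Kazeev–Khoromskij 2012, Cor. 2.5–2.6, Thm. 4.1)

Kazeev–Khoromskij, *Low-rank explicit QTT representation of the Laplace operator and its
inverse*, SIAM J. Matrix Anal. Appl. 33 (2012) 742–758 [KazeevKhoromskij2012]; numbering of
the MPI MIS preprint 75/2010.  Continuation of `QTTLaplaceMulti` (Cor. 2.3–2.4, the `D`-dimensional
operator (3) with Dirichlet factors `Δ_DD`) and `QTTLaplaceNeumannPeriodic` (Lem. 2.2, the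
one-dimensional `Δ_DN`, `Δ_ND`, `Δ_NN`, `Δ_P`): here the supercores of the `D`-dimensional operator
`Σ_k I ⊗ ⋯ ⊗ a_kΔ_k ⊗ ⋯ ⊗ I` whose one-dimensional factors carry Neumann boundary conditions.

* THE BLOCK-DIAGONAL SUPERCORE DEVICE ("QTT decompositions … may be derived by the same token",
  p. 16).  Every supercore of Cor. 2.4–2.7 is built from a one-dimensional uniform representation
  `Δ^{(d)} = α ⋈ C ⋈ ⋯ ⋈ C ⋈ β` (bond dimension `n`) by ONE construction: the middle QTT core is the
  block-diagonal `diag(C, I)` (`supCore`, bond dimension `n + 1`), the first core is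
  `E ⋈ diag(C, I)` with the `2 × (n+1)` bond matrix `E = [α 0; 0 1]` (`supBondL`), the last core is
  `diag(C, I) ⋈ B(a_k)` with the `(n+1) × 2` bond matrix `B(c) = [e₀, (cβ; 1)]` (`supBondR`;
  `B₁(c) = [e₀, cβ]`, `supBondR₁`, for the first supercore).  We prove once and for all
  (`supBondL_mul_chainProd_mul_supBondR`): whenever channel `0` of the automaton `α ⋈ C^{⋈d}`
  carries the diagonal indicator `𝟙[m = n]`,
  `E · diag(C,I)(i₁,j₁) ⋯ diag(C,I)(i_d,j_d) · B(c) = [𝟙[m=n] cΔ^{(d)}(m,n); 0 𝟙[m=n]]`, the block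
  entry of the middle supercore `[I^{⊗d} cΔ^{(d)}; 0 I^{⊗d}]` of Cor. 2.3 — together with the row form
  closing the first supercore `[I^{⊗d} a₁Δ₁]` (`vecMul_chainProd_vecMul_supBondR₁`) and the column
  form closing the last supercore `[a_DΔ_D; I^{⊗d}]` (`supBondL_mul_chainProd_mul_col`).  The
  assembled `D·d`-site train `supTrain` (junction cores `diag(C,I) ⋈ B(a_k) ⋈ E` of rank `2`
  between dimensions, Rem. 1.2 / Lem. 1.3) represents the operator (3) with all `d_k = d`
  (`eval_supTrain`, `ttMatrix_supTrain`: `= laplaceMulti a Δ^{(2^d)}` serialised dimension by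
  dimension), and its unfolding ranks obey the generic Thm. 4.1 pattern
  (`rank_unfolding_supTrain_le/_junction_le/_head_le/_first_le_of/_postJunction_le_of/
  _preJunction_le_of/_last_le_of`; the two-site factorisation device
  `TensorTrain.rank_unfolding_uniform_le_of_mul_core_eq_mul`).
* COROLLARY 2.5 (`Δ_DN`, and `Δ_ND` "with `I₂` replaced by `I₁`"), VERBATIM: the three displayed QTT
  decompositions — middle supercore
  `[I J' J I₂ 0; 0 0 0 0 I] ⋈ diag(W, I₂, I)^{⋈(d-2)} ⋈ [I a(2I-J-J'); 0 -aJ; 0 -aJ'; 0 -aI₂; 0 I]`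
  (`dnSupFirst_mul_chainProd_mul_dnSupLast`), first supercore
  `[I J' J I₂] ⋈ diag(W, I₂)^{⋈(d-2)} ⋈ [I a(2I-J-J'); 0 -aJ; 0 -aJ'; 0 -aI₂]`
  (`dnFirst_mul_chainProd_mul_dnSupLast₁`), last supercore before
  (`dnSupFirst_mul_chainProd_mul_dnSupLastCol`, first equality of the proof) and after the terminal
  rank reduction `… ⋈ [aI aJ' aJ 0; 0 aJ 0 0; 0 0 aJ' 0; 0 0 0 aI₂; ½I -½I -½I 0] ⋈ [2I-J-J'; -J; -J'; -I₂]`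
  (`dnSupFirst_mul_chainProd_mul_dnSupPenult_mul_dnLast`, over a field with `2 ≠ 0`); every
  displayed core is a named definition (`dnSupFirst`, `supCore_lapDNCore`, `dnSupLast`, `dnSupLast₁`,
  `dnSupLastCol`, `dnSupPenult`; `ndSup…` likewise) bridged to the device by a bookkeeping lemma;
  the assembled trains `lapMultiDNTrain`, `lapMultiNDTrain` with
  `ttMatrix = laplaceMulti a (Δ_DN^{(2^d)})` resp. `Δ_ND` (`ttMatrix_lapMultiDNTrain`,
  `ttMatrix_lapMultiNDTrain`).
* COROLLARY 2.6 (`Δ_NN`), VERBATIM up to one sign (reading note below): middle supercore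
  `[I J' J I₂ 0; 0 0 0 0 I] ⋈ [I J' J 0 I₁ 0; …; 0 0 0 I₂ -I₁ 0; 0 0 0 0 0 I] ⋈ diag(W, I₂, I₁, I)^{⋈(d-4)}
   ⋈ [I J' J 0 0; …; 0 0 0 aI₂ 0; 0 0 0 0 aI₁; 0 0 0 -I -I] ⋈ [I a(2I-J-J'); 0 -aJ; 0 -aJ'; 0 -I₂; 0 -I₁]`
  (`dnSupFirst_mul_nnSupSecond_mul_chainProd_mul_nnSupPenult_mul_nnSupLast`), first supercore
  (`dnFirst_mul_nnSecond_mul_chainProd_mul_nnSupLast₁`), last supercore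
  (`dnSupFirst_mul_nnSupSecond_mul_chainProd_mul_nnSupPenultLast_mul_dnLast`, field with `2 ≠ 0`;
  unreduced form `…_mul_nnSupLastCol`); the head and tail reductions
  `[I J' J I₂ 0; 0 0 0 0 I] ⋈ diag(M,1) = E ⋈ diag(W,I₂,I₁,I)` (`dnSupFirst_mul_nnSupM`) and
  `Y(a) ⋈ nnSupLast a = diag(W,I₂,I₁,I) ⋈ B(a)` (`nnSupY_mul_nnSupLast`), both resting on `I₁ + I₂ = I`;
  the assembled train `lapMultiNNTrain` with `ttMatrix = laplaceMulti a (Δ_NN^{(2^d)})`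
  (`ttMatrix_lapMultiNNTrain`).
* THEOREM 4.1, lines `Δ_DN^{(d…d)}, Δ_ND^{(d…d)} : 4…4, 2, 5…5, 2, …, 2, 5…5, 4` and
  `Δ_NN^{(d…d)} : 4, 5…5, 2, 5, 6…6, 5, 2, …, 2, 5, 6…6, 4`, as unfolding-rank bounds of the
  assembled trains: `rank_unfolding_lapMultiDNTrain_le` (`≤ 5`), `…_junction_le` (`≤ 2`),
  `…_head_le` (`≤ 4` inside the first supercore), `…_last_le` (`≤ 4`); the same for `ND`; and for
  `NN`: `≤ 6`, junction `≤ 2`, head `≤ 5`, first bond `≤ 4`, the bond after the first site of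
  every later dimension `≤ 5` (`…_postJunction_le`), the bond before the last site of every
  dimension `≤ 5` (`…_preJunction_le`), last bond `≤ 4`.

Conventions.  As in `QTTLaplace` / `QTTLaplaceMulti`: a QTT core is a function from digit pairs
`(i, j) ∈ Fin 2 × Fin 2` to bond matrices, the blocks `I, J, J', I₁, I₂` are `blkI, blkJ, blkJ',
blkI₁, blkI₂`, `W = [I J' J; 0 J 0; 0 0 J']` is the Laplace middle core (`lapCore`), the
one-dimensional data are those of Lem. 2.2 (`lapDNCore = diag(W, I₂)`, `lapNDCore = diag(W, I₁)`,
`lapNNCore = diag(W, I₂, I₁)` with boundary rows `(1,0,0,1)`, `(1,0,0,1,1)` and boundary columns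
`(2,-1,-1,-1)`, `(2,-1,-1,-1,-1)`), strong products of cores are products of bond matrices digit pair
by digit pair (`TensorTrain.chainProd`), and the block entry `((i₁…i_d), (j₁…j_d))` of a
`2^d × 2^d`-block matrix is read at `m = (i₁⋯i_d)₂`, `n = (j₁⋯j_d)₂` (`quanticsEquiv`, big-endian).
The identity channel is the LAST index of `Fin (n + 1)` (`Fin.snoc`).

Reading notes.  (1) The displayed cores are block matrices with blank entries `= 0`; the middle
cores `diag(W, I₂, I)` (`5 × 5`) and `diag(W, I₂, I₁, I)` (`6 × 6`) are `supCore_lapDNCore`,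
`supCore_lapNNCore` written out.  (2) Exponents: Cor. 2.5 is stated for `d ≥ 3` and Cor. 2.6 for
`d ≥ 4`; our versions are indexed by the number `k` of generic middle cores, so the middle / first
displays hold for every `d = k + 2 ≥ 2` (Cor. 2.5) resp. `d = k + 4`, `k + 3` (Cor. 2.6), the
reduced last displays for `d = k + 3` resp. `k + 4`, and the uniform-form identity for every
`d ≥ 0`.  (3) In the third display of Cor. 2.6 the preprint prints the fifth row of the penultimate
core as `½a_kI₁ -½a_kI₁ -½a_kI₁ -a_kI₁`; multiplying out shows the signs of the first three blocks
must be `-½a_kI₁ ½a_kI₁ ½a_kI₁`: that row has to sweep the last core `(2I-J-J', -J, -J', -I₂)ᵀ`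
into `-a_kI₁` (completing the `I₁`-channel term `-a_kI₁^{⊗d} = -a_k𝟙[m=n=0]` of eq. (4)), which
forces `a_kI₁ ⊗ (-½, ½, ½, -1)` = `a_kI₁ ⊗` the last row of the bond matrix `N` of Lem. 2.2; the
printed signs give `+a_kI₁ ⊗ (I+I₂)` in the last two factors instead.  We formalise the forced
reading (`nnSupPenultLast`, swept in `nnSupZ_mulVec_lapDNCore_mulVec`) and flag it here; all other
cores are as printed.  (4) The trains `lapMulti??Train` are
the uniform-bond-dimension (`5` resp. `6`) forms; the paper's reduced bond dimensions at the heads,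
tails and junctions are recovered as the unfolding-rank bounds of Thm. 4.1 (an unfolding rank is a
property of the represented tensor, not of the representation).  (5) `Δ_ND`: Cor. 2.5's last
sentence; every `dn…` declaration has an `nd…` twin with `I₁` for `I₂`.

Not formalised here (honest scope).  Cor. 2.7 (periodic factors `Δ_P`, the same device with the
rank-`5` core `diag(W, J, J')` and the reductions through `P = J + J'` of Lem. 2.2) and its Thm. 4.1
line — deferred to a sequel; distinct level numbers `d_k` per dimension (we take all `d_k = d`; the
general case is the same computation with `Fin.append` bookkeeping); the minimality discussion of
the ranks (Rem. 4.2) — we prove upper bounds only; §3 (inverse Laplacian) and §5 (numerics).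

## References
* [KazeevKhoromskij2012] V. A. Kazeev, B. N. Khoromskij, Low-rank explicit QTT representation of
  the Laplace operator and its inverse, SIAM J. Matrix Anal. Appl. 33(3) (2012) 742–758
  (MPI MIS preprint 75/2010), Cor. 2.3, 2.5, 2.6, Rem. 1.2, Lem. 2.2, Thm. 4.1.

AI-produced formalisation (H21 engines group, seat eng-quad-2, 2026-08-23); no facts, no axioms
beyond Mathlib's, no `sorry`.
-/

open Matrix Finset

namespace Literature.LinearAlgebra.TensorNetworks

universe u

/-! ### The block-diagonal supercore device `diag(C, I)` (Cor. 2.4–2.7 "by the same token") -/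

section Device

variable (K : Type u) [CommRing K] {n : ℕ}

/-- THE BLOCK-DIAGONAL MIDDLE CORE `diag(C, I)` of the supercores of Cor. 2.4–2.7: a
one-dimensional QTT core `C` (bond dimension `n`; `W` for `Δ_DD`, `diag(W, I₂)` for `Δ_DN`,
`diag(W, I₁)` for `Δ_ND`, `diag(W, I₂, I₁)` for `Δ_NN`) in the first `n` channels and the block `I`
in one extra channel carrying the factor `I^{⊗d}` of the supercore `[I^{⊗d} a_kΔ_k; 0 I^{⊗d}]`
("QTT decompositions … may be derived by the same token", p. 16; uniform-form device common to all
boundary conditions).  [cite: KazeevKhoromskij2012, Cor. 2.5] -/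
def supCore (C : Fin 2 × Fin 2 → Matrix (Fin n) (Fin n) K) (p : Fin 2 × Fin 2) :
    Matrix (Fin (n + 1)) (Fin (n + 1)) K :=
  Matrix.of fun i j =>
    if hi : (i : ℕ) < n then (if hj : (j : ℕ) < n then C p ⟨i, hi⟩ ⟨j, hj⟩ else 0)
    else if (j : ℕ) < n then 0 else blkI K p

/-- THE LEFT BOND MATRIX `E = [α 0; 0 1]` (`2 × (n+1)`) of a supercore: the boundary row `α` of the
one-dimensional train padded by `0`, and the unit row of the identity channel (`E ⋈ diag(C, I)` is
the first QTT core of the middle supercore).  [cite: KazeevKhoromskij2012, Cor. 2.5] -/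
def supBondL (α : Fin n → K) : Matrix (Fin 2) (Fin (n + 1)) K :=
  Matrix.of ![Fin.snoc α 0, Fin.snoc 0 1]

/-- THE RIGHT BOND MATRIX `B(c) = [e₀, (cβ; 1)]` (`(n+1) × 2`) of a supercore: first column the unit
vector of the diagonal channel `0`, second column the boundary column `β` of the one-dimensional
train scaled by the weight `c = a_k` and completed by `1` in the identity channel
(`diag(C, I) ⋈ B(a_k)` is the last QTT core of the middle supercore).
[cite: KazeevKhoromskij2012, Cor. 2.5] -/
def supBondR (c : K) (β : Fin n → K) : Matrix (Fin (n + 1)) (Fin 2) K :=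
  Matrix.of fun i j =>
    if j = 0 then (if (i : ℕ) = 0 then 1 else 0) else (Fin.snoc (c • β) (1 : K) : Fin (n + 1) → K) i

/-- The variant `B₁(c) = [e₀, cβ]` (`n × 2`) closing the FIRST supercore `[I^{⊗d} a₁Δ₁]`
(`C ⋈ B₁(a₁)` is its last QTT core).  [cite: KazeevKhoromskij2012, Cor. 2.5] -/
def supBondR₁ (c : K) (β : Fin n → K) : Matrix (Fin n) (Fin 2) K :=
  Matrix.of fun i j => if j = 0 then (if (i : ℕ) = 0 then 1 else 0) else c * β i

/-- The embedding `[I_n 0]` (`n × (n+1)`) of the one-dimensional channels (bookkeeping matrix of the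
rank count inside the first supercore).  [cite: KazeevKhoromskij2012, Thm. 4.1] -/
def supEmbed : Matrix (Fin n) (Fin (n + 1)) K :=
  Matrix.of fun i j => if j = Fin.castSucc i then 1 else 0

/-- THE JUNCTION CORE between two consecutive dimensions of the assembled train:
`diag(C, I) ⋈ B(a_k) ⋈ E` (square of size `n + 1`, rank `≤ 2`), the last QTT core of supercore `k`
merged with the rank-2 bond and the bond matrix of supercore `k + 1` (Rem. 1.2 / Lem. 1.3).
[cite: KazeevKhoromskij2012, Cor. 2.5] -/
def supJunction (C : Fin 2 × Fin 2 → Matrix (Fin n) (Fin n) K) (α β : Fin n → K) (c : K)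
    (p : Fin 2 × Fin 2) : Matrix (Fin (n + 1)) (Fin (n + 1)) K :=
  supCore K C p * supBondR K c β * supBondL K α

/-- THE CORES OF THE ASSEMBLED TRAIN, all dimensions of `d` bits: site `ℓ = k·d + t` carries bit `t`
of dimension `k`; it holds `diag(C, I)` for `t < d - 1` and the junction core with weight `a_k` for
`t = d - 1`.  [cite: KazeevKhoromskij2012, Cor. 2.5] -/
def supSite (C : Fin 2 × Fin 2 → Matrix (Fin n) (Fin n) K) (α β : Fin n → K) (a : ℕ → K) (d ℓ : ℕ)
    (p : Fin 2 × Fin 2) : Matrix (Fin (n + 1)) (Fin (n + 1)) K :=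
  if ℓ % d = d - 1 then supJunction K C α β (a (ℓ / d)) p else supCore K C p

/-- THE ASSEMBLED QTT TRAIN OF THE `D`-DIMENSIONAL LAPLACE-TYPE OPERATOR
`Σ_k I^{⊗d} ⊗ ⋯ ⊗ a_kΔ^{(d)} ⊗ ⋯ ⊗ I^{⊗d}` built from a one-dimensional uniform representation
`Δ^{(d)} = α ⋈ C^{⋈ d} ⋈ β` (Cor. 2.3 with the supercores of Cor. 2.4–2.7 substituted, Rem. 1.2):
`D·d` sites, uniform bond dimension `n + 1`, cores `supSite`, boundary vectors `(α, 0)` and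
`(0, …, 0, 1)`.  [cite: KazeevKhoromskij2012, Cor. 2.5] -/
def supTrain (C : Fin 2 × Fin 2 → Matrix (Fin n) (Fin n) K) (α β : Fin n → K) (a : ℕ → K)
    (D d : ℕ) : TensorTrain K (Fin 2 × Fin 2) (D * d) :=
  TensorTrain.uniform (D * d) (n + 1) (supSite K C α β a d) (Fin.snoc α 0) (Fin.snoc 0 1)

variable {K}

/-- ROW PROPAGATION THROUGH `diag(C, I)`: the first `n` channels are multiplied by `C`, the
identity channel by the block `I`.  [cite: KazeevKhoromskij2012, Cor. 2.5] -/
theorem vecMul_supCore (C : Fin 2 × Fin 2 → Matrix (Fin n) (Fin n) K) (p : Fin 2 × Fin 2)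
    (v : Fin (n + 1) → K) :
    v ᵥ* supCore K C p = Fin.snoc (Fin.init v ᵥ* C p) (v (Fin.last n) * blkI K p) := by
  ext j
  rw [Matrix.vecMul, dotProduct, Fin.sum_univ_castSucc]
  refine Fin.lastCases ?_ (fun j => ?_) j
  · simp [supCore]
  · simp [supCore, Matrix.vecMul, dotProduct, Fin.init]

/-- ROW PROPAGATION THROUGH A CHAIN OF CORES `diag(C, I)`:
`v · diag(C,I)(g₀) ⋯ diag(C,I)(g_{d-1}) = (v' · C(g₀) ⋯ C(g_{d-1}), v_n · ∏_r I(g_r))` — the two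
diagonal blocks never mix.  [cite: KazeevKhoromskij2012, Cor. 2.5] -/
theorem vecMul_chainProd_supCore (C : Fin 2 × Fin 2 → Matrix (Fin n) (Fin n) K)
    (v : Fin (n + 1) → K) : ∀ (d : ℕ) (g : Fin d → Fin 2 × Fin 2),
      v ᵥ* TensorTrain.chainProd (fun _ => supCore K C) d g =
        Fin.snoc (Fin.init v ᵥ* TensorTrain.chainProd (fun _ => C) d g)
          (v (Fin.last n) * ∏ r, blkI K (g r))
  | 0, g => by
      simp only [TensorTrain.chainProd, Matrix.vecMul_one, Finset.univ_eq_empty,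
        Finset.prod_empty, mul_one]
      exact (Fin.snoc_init_self v).symm
  | d + 1, g => by
      rw [TensorTrain.chainProd, TensorTrain.chainProd, ← Matrix.vecMul_vecMul,
        vecMul_chainProd_supCore C v d (Fin.init g), vecMul_supCore, ← Matrix.vecMul_vecMul,
        Fin.prod_univ_castSucc, ← mul_assoc, Fin.init_snoc, Fin.snoc_last]
      rfl

/-- THE IDENTITY CHANNEL: `∏_r I(i_r, j_r) = 𝟙[m = n]` (the block `I^{⊗d}`).
[cite: KazeevKhoromskij2012, Cor. 2.5] -/
theorem prod_blkI (d : ℕ) (σ μ : Fin d → Fin 2) :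
    ∏ r, blkI K (σ r, μ r) =
      (1 : Matrix (Fin (2 ^ d)) (Fin (2 ^ d)) K) (quanticsEquiv 2 d σ) (quanticsEquiv 2 d μ) := by
  rw [Matrix.one_apply]
  simp [blkI, Finset.prod_boole, funext_iff]

/-- [folklore] Rows of `E` (bookkeeping). -/
private theorem supBondL_zero (α : Fin n → K) : supBondL K α 0 = Fin.snoc α 0 := rfl

/-- [folklore] Rows of `E` (bookkeeping). -/
private theorem supBondL_one (α : Fin n → K) : supBondL K α 1 = Fin.snoc 0 1 := rfl

/-- [folklore] Pairing of extended vectors (bookkeeping). -/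
private theorem snoc_dotProduct_snoc (u w : Fin n → K) (a b : K) :
    Fin.snoc u a ⬝ᵥ Fin.snoc w b = u ⬝ᵥ w + a * b := by
  simp [dotProduct, Fin.sum_univ_castSucc]

/-- [folklore] Pairing with the unit vector of channel `0` (bookkeeping). -/
private theorem dotProduct_indicator_zero (S : Fin (n + 1) → K) :
    S ⬝ᵥ (fun l => if (l : ℕ) = 0 then (1 : K) else 0) = S 0 := by
  simp [dotProduct]

/-- [folklore] Columns of `B(c)` (bookkeeping). -/
private theorem supBondR_col_zero (c : K) (β : Fin (n + 1) → K) :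
    (fun i => supBondR K c β i 0) =
      (Fin.snoc (fun l : Fin (n + 1) => if (l : ℕ) = 0 then (1 : K) else 0) (0 : K) :
        Fin (n + 2) → K) := by
  funext i
  refine Fin.lastCases ?_ (fun l => ?_) i <;> simp [supBondR]

/-- [folklore] Columns of `B(c)` (bookkeeping). -/
private theorem supBondR_col_one (c : K) (β : Fin n → K) :
    (fun i => supBondR K c β i 1) = (Fin.snoc (c • β) (1 : K) : Fin (n + 1) → K) := by
  funext i
  simp [supBondR]

/-- The boundary row of the assembled train is `(1, 0) ⋈ E` (bookkeeping).
[cite: KazeevKhoromskij2012, Cor. 2.5] -/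
theorem vecMul_supBondL (α : Fin n → K) : ![(1 : K), 0] ᵥ* supBondL K α = Fin.snoc α 0 := by
  ext j
  simp [supBondL, Matrix.vecMul, dotProduct, Fin.sum_univ_two]

/-- The boundary column of the assembled train: `E ⋈ (0, …, 0, 1)ᵀ = (0, 1)ᵀ` (bookkeeping).
[cite: KazeevKhoromskij2012, Cor. 2.5] -/
theorem supBondL_mulVec (α : Fin n → K) :
    supBondL K α *ᵥ (Fin.snoc 0 1 : Fin (n + 1) → K) = ![0, 1] := by
  ext i
  fin_cases i
  · change supBondL K α 0 ⬝ᵥ Fin.snoc 0 1 = 0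
    rw [supBondL_zero, snoc_dotProduct_snoc, dotProduct_zero, zero_mul, add_zero]
  · change supBondL K α 1 ⬝ᵥ Fin.snoc 0 1 = 1
    rw [supBondL_one, snoc_dotProduct_snoc, dotProduct_zero, one_mul, zero_add]

/-- `u ⋈ [I_n 0] = (u, 0)` (bookkeeping).  [cite: KazeevKhoromskij2012, Thm. 4.1] -/
theorem vecMul_supEmbed (u : Fin n → K) : u ᵥ* supEmbed K = Fin.snoc u 0 := by
  ext j
  refine Fin.lastCases ?_ (fun j => ?_) j
  · rw [Fin.snoc_last, Matrix.vecMul, dotProduct]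
    exact Finset.sum_eq_zero fun i _ => by
      rw [supEmbed, Matrix.of_apply, if_neg (Fin.castSucc_lt_last i).ne', mul_zero]
  · simp [supEmbed, Matrix.vecMul, dotProduct, Fin.castSucc_inj]

/-- CLOSING A SUPERCORE WITH `B(c)`: a row state `(S, z)` is mapped to `(S₀, c·(S ⬝ β) + z)`.
[cite: KazeevKhoromskij2012, Cor. 2.5] -/
theorem snoc_vecMul_supBondR (S : Fin (n + 1) → K) (z c : K) (β : Fin (n + 1) → K) :
    Fin.snoc S z ᵥ* supBondR K c β = ![S 0, c * (S ⬝ᵥ β) + z] := by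
  ext j
  fin_cases j
  · change Fin.snoc S z ⬝ᵥ (fun i => supBondR K c β i 0) = S 0
    rw [supBondR_col_zero, snoc_dotProduct_snoc, dotProduct_indicator_zero, mul_zero, add_zero]
  · change Fin.snoc S z ⬝ᵥ (fun i => supBondR K c β i 1) = c * (S ⬝ᵥ β) + z
    rw [supBondR_col_one, snoc_dotProduct_snoc, dotProduct_smul, smul_eq_mul, mul_one]

/-- CLOSING THE FIRST SUPERCORE WITH `B₁(c)`: `S ↦ (S₀, c·(S ⬝ β))`.
[cite: KazeevKhoromskij2012, Cor. 2.5] -/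
theorem vecMul_supBondR₁ (S : Fin (n + 1) → K) (c : K) (β : Fin (n + 1) → K) :
    S ᵥ* supBondR₁ K c β = ![S 0, c * (S ⬝ᵥ β)] := by
  ext j
  fin_cases j
  · change S ⬝ᵥ (fun i => supBondR₁ K c β i 0) = S 0
    rw [show (fun i => supBondR₁ K c β i 0) = fun l : Fin (n + 1) => if (l : ℕ) = 0 then (1 : K) else 0
      from funext fun i => by simp [supBondR₁], dotProduct_indicator_zero]
  · change S ⬝ᵥ (fun i => supBondR₁ K c β i 1) = c * (S ⬝ᵥ β)
    rw [show (fun i => supBondR₁ K c β i 1) = c • β from funext fun i => by simp [supBondR₁],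
      dotProduct_smul, smul_eq_mul]

/-- [folklore] Entries of a triple product as an iterated vector–matrix product (bookkeeping). -/
private theorem mul_mul_apply_eq_vecMul {p q r : ℕ} (A : Matrix (Fin p) (Fin q) K)
    (X : Matrix (Fin q) (Fin q) K) (B : Matrix (Fin q) (Fin r) K) (i : Fin p) (j : Fin r) :
    (A * X * B) i j = ((A i ᵥ* X) ᵥ* B) j := rfl

/-- [folklore] A matrix times a one-column matrix (bookkeeping). -/
private theorem mul_of_col {p q : ℕ} (X : Matrix (Fin p) (Fin q) K) (v : Fin q → K) :
    X * Matrix.of (fun i (_ : Fin 1) => v i) = Matrix.of fun i (_ : Fin 1) => (X *ᵥ v) i := rfl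

/-- [folklore] A one-row matrix times a matrix (bookkeeping). -/
private theorem of_row_mul {p q : ℕ} (v : Fin p → K) (X : Matrix (Fin p) (Fin q) K) :
    Matrix.of (fun (_ : Fin 1) j => v j) * X = Matrix.of fun (_ : Fin 1) j => (v ᵥ* X) j := rfl

/-- THE MIDDLE SUPERCORE IDENTITY (uniform form) for every one-dimensional representation
`Δ^{(d)} = α ⋈ C^{⋈ d} ⋈ β` whose channel `0` carries the diagonal indicator: for every `d ≥ 0`,
`E · diag(C, I)(i₁,j₁) ⋯ diag(C, I)(i_d,j_d) · B(c) = [𝟙[m = n]  cΔ^{(d)}(m, n); 0  𝟙[m = n]]`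
— the `((i₁…i_d), (j₁…j_d))` block entry of `[I^{⊗d} cΔ^{(d)}; 0 I^{⊗d}]`, i.e. the core of Cor. 2.3
at this dimension read at `(m, n)`, `m = (i₁⋯i_d)₂`, `n = (j₁⋯j_d)₂`.
[cite: KazeevKhoromskij2012, Cor. 2.5] -/
theorem supBondL_mul_chainProd_mul_supBondR (C : Fin 2 × Fin 2 → Matrix (Fin (n + 1)) (Fin (n + 1)) K)
    (α β : Fin (n + 1) → K) {d : ℕ} (Δ : Matrix (Fin (2 ^ d)) (Fin (2 ^ d)) K) (c : K)
    (σ μ : Fin d → Fin 2)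
    (h₀ : (α ᵥ* TensorTrain.chainProd (fun _ => C) d (fun r => (σ r, μ r))) 0 =
      (1 : Matrix (Fin (2 ^ d)) (Fin (2 ^ d)) K) (quanticsEquiv 2 d σ) (quanticsEquiv 2 d μ))
    (hΔ : α ᵥ* TensorTrain.chainProd (fun _ => C) d (fun r => (σ r, μ r)) ⬝ᵥ β =
      Δ (quanticsEquiv 2 d σ) (quanticsEquiv 2 d μ)) :
    supBondL K α * TensorTrain.chainProd (fun _ => supCore K C) d (fun r => (σ r, μ r)) *
        supBondR K c β =
      laplaceMultiCore c Δ (quanticsEquiv 2 d σ, quanticsEquiv 2 d μ) := by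
  have hid := prod_blkI (K := K) d σ μ
  ext i j
  rw [mul_mul_apply_eq_vecMul]
  fin_cases i
  · change ((supBondL K α 0 ᵥ* TensorTrain.chainProd (fun _ => supCore K C) d (fun r => (σ r, μ r))) ᵥ*
        supBondR K c β) j = laplaceMultiCore c Δ (quanticsEquiv 2 d σ, quanticsEquiv 2 d μ) 0 j
    rw [supBondL_zero, vecMul_chainProd_supCore, Fin.init_snoc, Fin.snoc_last, zero_mul,
      snoc_vecMul_supBondR, h₀, hΔ, add_zero]
    fin_cases j <;> simp [laplaceMultiCore]
  · change ((supBondL K α 1 ᵥ* TensorTrain.chainProd (fun _ => supCore K C) d (fun r => (σ r, μ r))) ᵥ*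
        supBondR K c β) j = laplaceMultiCore c Δ (quanticsEquiv 2 d σ, quanticsEquiv 2 d μ) 1 j
    rw [supBondL_one, vecMul_chainProd_supCore, Fin.init_snoc, Fin.snoc_last, one_mul,
      Matrix.zero_vecMul, snoc_vecMul_supBondR, hid]
    fin_cases j <;> simp [laplaceMultiCore]

/-- The same identity for an arbitrary string of bit pairs, bracketed `E · (chain · B(c))` (the
form used at the junctions of the assembled train).  [cite: KazeevKhoromskij2012, Cor. 2.5] -/
theorem supBondL_mul_chainProd_mul_supBondR' (C : Fin 2 × Fin 2 → Matrix (Fin (n + 1)) (Fin (n + 1)) K)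
    (α β : Fin (n + 1) → K) {d : ℕ} (Δ : Matrix (Fin (2 ^ d)) (Fin (2 ^ d)) K) (c : K)
    (h₀ : ∀ σ μ : Fin d → Fin 2, (α ᵥ* TensorTrain.chainProd (fun _ => C) d (fun r => (σ r, μ r))) 0 =
      (1 : Matrix (Fin (2 ^ d)) (Fin (2 ^ d)) K) (quanticsEquiv 2 d σ) (quanticsEquiv 2 d μ))
    (hΔ : ∀ σ μ : Fin d → Fin 2, α ᵥ* TensorTrain.chainProd (fun _ => C) d (fun r => (σ r, μ r)) ⬝ᵥ β =
      Δ (quanticsEquiv 2 d σ) (quanticsEquiv 2 d μ))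
    (g : Fin d → Fin 2 × Fin 2) :
    supBondL K α * (TensorTrain.chainProd (fun _ => supCore K C) d g * supBondR K c β) =
      laplaceMultiCore c Δ
        (quanticsEquiv 2 d (fun t => (g t).1), quanticsEquiv 2 d (fun t => (g t).2)) := by
  rw [← Matrix.mul_assoc]
  exact supBondL_mul_chainProd_mul_supBondR C α β Δ c (fun t => (g t).1) (fun t => (g t).2)
    (h₀ _ _) (hΔ _ _)

/-- CLOSING THE FIRST SUPERCORE (row form of its identity): the boundary row swept through `d`
one-dimensional cores and closed by `B₁(c)` is `(𝟙[m = n], cΔ^{(d)}(m, n))` — the block entry of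
`[I^{⊗d} cΔ^{(d)}]`.  [cite: KazeevKhoromskij2012, Cor. 2.5] -/
theorem vecMul_chainProd_vecMul_supBondR₁ (C : Fin 2 × Fin 2 → Matrix (Fin (n + 1)) (Fin (n + 1)) K)
    (α β : Fin (n + 1) → K) {d : ℕ} (Δ : Matrix (Fin (2 ^ d)) (Fin (2 ^ d)) K) (c : K)
    (σ μ : Fin d → Fin 2)
    (h₀ : (α ᵥ* TensorTrain.chainProd (fun _ => C) d (fun r => (σ r, μ r))) 0 =
      (1 : Matrix (Fin (2 ^ d)) (Fin (2 ^ d)) K) (quanticsEquiv 2 d σ) (quanticsEquiv 2 d μ))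
    (hΔ : α ᵥ* TensorTrain.chainProd (fun _ => C) d (fun r => (σ r, μ r)) ⬝ᵥ β =
      Δ (quanticsEquiv 2 d σ) (quanticsEquiv 2 d μ)) :
    (α ᵥ* TensorTrain.chainProd (fun _ => C) d (fun r => (σ r, μ r))) ᵥ* supBondR₁ K c β =
      ![(1 : Matrix (Fin (2 ^ d)) (Fin (2 ^ d)) K) (quanticsEquiv 2 d σ) (quanticsEquiv 2 d μ),
        c * Δ (quanticsEquiv 2 d σ) (quanticsEquiv 2 d μ)] := by
  rw [vecMul_supBondR₁, h₀, hΔ]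

/-- CLOSING THE LAST SUPERCORE (column form of the middle identity): closed on the right by the
column `B(c) ⋈ (0, 1)ᵀ = (cβ; 1)` instead of `B(c)`, the chain gives the column
`(cΔ^{(d)}(m, n); 𝟙[m = n])` — the block entry of `[a_DΔ^{(d)}; I^{⊗d}]`.
[cite: KazeevKhoromskij2012, Cor. 2.5] -/
theorem supBondL_mul_chainProd_mul_col (C : Fin 2 × Fin 2 → Matrix (Fin (n + 1)) (Fin (n + 1)) K)
    (α β : Fin (n + 1) → K) {d : ℕ} (Δ : Matrix (Fin (2 ^ d)) (Fin (2 ^ d)) K) (c : K)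
    (σ μ : Fin d → Fin 2)
    (h₀ : (α ᵥ* TensorTrain.chainProd (fun _ => C) d (fun r => (σ r, μ r))) 0 =
      (1 : Matrix (Fin (2 ^ d)) (Fin (2 ^ d)) K) (quanticsEquiv 2 d σ) (quanticsEquiv 2 d μ))
    (hΔ : α ᵥ* TensorTrain.chainProd (fun _ => C) d (fun r => (σ r, μ r)) ⬝ᵥ β =
      Δ (quanticsEquiv 2 d σ) (quanticsEquiv 2 d μ)) :
    supBondL K α * TensorTrain.chainProd (fun _ => supCore K C) d (fun r => (σ r, μ r)) *
        Matrix.of (fun i (_ : Fin 1) => (supBondR K c β *ᵥ ![(0 : K), 1]) i) =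
      !![c * Δ (quanticsEquiv 2 d σ) (quanticsEquiv 2 d μ);
        (1 : Matrix (Fin (2 ^ d)) (Fin (2 ^ d)) K) (quanticsEquiv 2 d σ) (quanticsEquiv 2 d μ)] := by
  rw [← mul_of_col, ← Matrix.mul_assoc, supBondL_mul_chainProd_mul_supBondR C α β Δ c σ μ h₀ hΔ]
  ext i j
  fin_cases i <;> fin_cases j <;>
    simp [laplaceMultiCore, Matrix.mul_apply, Fin.sum_univ_two]

/-- [folklore] Site arithmetic: the bit index of site `k·d + t` is `t` (bookkeeping). -/
private theorem site_mod (k d t : ℕ) (ht : t < d) : (k * d + t) % d = t := by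
  rw [Nat.mul_comm, Nat.mul_add_mod, Nat.mod_eq_of_lt ht]

/-- [folklore] Site arithmetic: the dimension index of site `k·d + t` is `k` (bookkeeping). -/
private theorem site_div (k d t : ℕ) (ht : t < d) : (k * d + t) / d = k := by
  rw [Nat.mul_comm, Nat.mul_add_div (by omega), Nat.div_eq_of_lt ht, Nat.add_zero]

/-- THE SUPERCORE OF DIMENSION `k` INSIDE THE ASSEMBLED TRAIN: the chain over the `d + 1` sites of
dimension `k` is `diag(C, I)(i₁,j₁) ⋯ diag(C, I)(i_{d+1},j_{d+1}) · B(a_k) · E` — the middle supercore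
with its terminal cores factored through the rank-2 bond.  [cite: KazeevKhoromskij2012, Cor. 2.5] -/
theorem chainProd_supTrain_block (C : Fin 2 × Fin 2 → Matrix (Fin n) (Fin n) K) (α β : Fin n → K)
    (a : ℕ → K) (k d : ℕ) (g : Fin (d + 1) → Fin 2 × Fin 2) :
    TensorTrain.chainProd (fun t => supSite K C α β a (d + 1) (k * (d + 1) + t)) (d + 1) g =
      TensorTrain.chainProd (fun _ => supCore K C) (d + 1) g * supBondR K (a k) β * supBondL K α := by
  have hcongr : TensorTrain.chainProd (fun t => supSite K C α β a (d + 1) (k * (d + 1) + t)) d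
        (Fin.init g) =
      TensorTrain.chainProd (fun _ => supCore K C) d (Fin.init g) :=
    TensorTrain.chainProd_congr (fun t ht p => by
      rw [supSite, site_mod k (d + 1) t (by omega), if_neg (by omega)]) (Fin.init g)
  have hlast : supSite K C α β a (d + 1) (k * (d + 1) + d) (g (Fin.last d)) =
      supJunction K C α β (a k) (g (Fin.last d)) := by
    rw [supSite, site_mod k (d + 1) d (by omega), site_div k (d + 1) d (by omega), if_pos (by omega)]
  rw [TensorTrain.chainProd, hcongr, hlast, TensorTrain.chainProd, supJunction]
  simp only [Matrix.mul_assoc]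

/-- COROLLARY 2.3 WITH THE SUPERCORES SUBSTITUTED (Rem. 1.2), uniform form, every boundary condition
at once: for `d ≥ 1` the value of the assembled train at the bit-pair string `(τ_ℓ, τ'_ℓ)_{ℓ < D·d}`
is the entry of `Σ_k I ⊗ ⋯ ⊗ a_kΔ^{(d)} ⊗ ⋯ ⊗ I` (eq. (3), all `d_k = d`) at the multi-indices read off
dimension by dimension (`serialEquiv`), whenever the one-dimensional representation
`α ⋈ C^{⋈ d} ⋈ β = Δ^{(d)}` has the diagonal indicator in channel `0`.
[cite: KazeevKhoromskij2012, Cor. 2.5] -/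
theorem eval_supTrain (C : Fin 2 × Fin 2 → Matrix (Fin (n + 1)) (Fin (n + 1)) K)
    (α β : Fin (n + 1) → K) (a : ℕ → K) (D d : ℕ) (hd : 0 < d)
    (Δ : Matrix (Fin (2 ^ d)) (Fin (2 ^ d)) K)
    (h₀ : ∀ σ μ : Fin d → Fin 2, (α ᵥ* TensorTrain.chainProd (fun _ => C) d (fun r => (σ r, μ r))) 0 =
      (1 : Matrix (Fin (2 ^ d)) (Fin (2 ^ d)) K) (quanticsEquiv 2 d σ) (quanticsEquiv 2 d μ))
    (hΔ : ∀ σ μ : Fin d → Fin 2, α ᵥ* TensorTrain.chainProd (fun _ => C) d (fun r => (σ r, μ r)) ⬝ᵥ β =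
      Δ (quanticsEquiv 2 d σ) (quanticsEquiv 2 d μ))
    (τ τ' : Fin (D * d) → Fin 2) :
    (supTrain K C α β a D d).eval (fun ℓ => (τ ℓ, τ' ℓ)) =
      laplaceMulti (fun k : Fin D => a k) (fun _ => Δ) (serialEquiv 2 D d τ) (serialEquiv 2 D d τ') := by
  obtain ⟨d, rfl⟩ := Nat.exists_eq_add_one_of_ne_zero hd.ne'
  rw [supTrain, TensorTrain.eval_uniform, TensorTrain.chainProd_mul_eq_chainProd_chainProd,
    TensorTrain.chainProd_congr (fun k _ g => chainProd_supTrain_block C α β a k d g),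
    ← vecMul_supBondL α,
    TensorTrain.vecMul_vecMul_chainProd_mul (supBondL K α)
      (fun k g => TensorTrain.chainProd (fun _ => supCore K C) (d + 1) g * supBondR K (a k) β)
      ![1, 0] D,
    ← Matrix.dotProduct_mulVec, supBondL_mulVec,
    TensorTrain.chainProd_congr (fun k _ g =>
      supBondL_mul_chainProd_mul_supBondR' C α β Δ (a k) h₀ hΔ g),
    TensorTrain.chainProd_comp (fun k p => laplaceMultiCore (a k) Δ p)
      (fun g : Fin (d + 1) → Fin 2 × Fin 2 =>
        (quanticsEquiv 2 (d + 1) (fun t => (g t).1), quanticsEquiv 2 (d + 1) (fun t => (g t).2))) D,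
    ← TensorTrain.eval_uniform, show TensorTrain.uniform D 2 (fun k p => laplaceMultiCore (a k) Δ p)
        ![1, 0] ![0, 1] = laplaceMultiTrain a (fun _ => Δ) D from rfl,
    ← congrFun (congrFun (ttMatrix_laplaceMultiTrain a (fun _ => Δ) D) _) _,
    TensorTrain.ttMatrix_apply]
  rfl

/-- The same statement at the level of matrices: the TT matrix of the assembled train is the
`D`-dimensional operator (3) with its multi-indices serialised dimension by dimension.
[cite: KazeevKhoromskij2012, Cor. 2.5] -/
theorem ttMatrix_supTrain (C : Fin 2 × Fin 2 → Matrix (Fin (n + 1)) (Fin (n + 1)) K)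
    (α β : Fin (n + 1) → K) (a : ℕ → K) (D d : ℕ) (hd : 0 < d)
    (Δ : Matrix (Fin (2 ^ d)) (Fin (2 ^ d)) K)
    (h₀ : ∀ σ μ : Fin d → Fin 2, (α ᵥ* TensorTrain.chainProd (fun _ => C) d (fun r => (σ r, μ r))) 0 =
      (1 : Matrix (Fin (2 ^ d)) (Fin (2 ^ d)) K) (quanticsEquiv 2 d σ) (quanticsEquiv 2 d μ))
    (hΔ : ∀ σ μ : Fin d → Fin 2, α ᵥ* TensorTrain.chainProd (fun _ => C) d (fun r => (σ r, μ r)) ⬝ᵥ β =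
      Δ (quanticsEquiv 2 d σ) (quanticsEquiv 2 d μ)) :
    (supTrain K C α β a D d).ttMatrix =
      (laplaceMulti (fun k : Fin D => a k) (fun _ => Δ)).submatrix (serialEquiv 2 D d)
        (serialEquiv 2 D d) := by
  ext τ τ'
  exact eval_supTrain C α β a D d hd Δ h₀ hΔ τ τ'

end Device

/-! ### The rank profile of an assembled train (Thm. 4.1, uniform-form device) -/

section DeviceRanks

variable {K : Type u} [Field K] {n : ℕ}

/-- A FACTORED PAIR OF CORES BOUNDS THE NEXT UNFOLDING RANK: if the product of the cores at sites
`k` and `k + 1` of a uniform train factors as `G_k(a) G_{k+1}(b) = X(a,b) · Y` through `r`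
intermediate indices, the unfolding matrix across the bond after site `k + 1` has rank `≤ r`
(the rank-reduction step of the cited proof when the dependence among QTT blocks involves two
neighbouring cores).  [cite: KazeevKhoromskij2012, Thm. 4.1] -/
theorem TensorTrain.rank_unfolding_uniform_le_of_mul_core_eq_mul {σ : Type*} [Fintype σ]
    {m₀ r L : ℕ} (G : ℕ → σ → Matrix (Fin m₀) (Fin m₀) K) (α β : Fin m₀ → K) (k m : ℕ)
    (h : k + 2 + m = L) (X : σ → σ → Matrix (Fin m₀) (Fin r) K) (Y : Matrix (Fin r) (Fin m₀) K)
    (hG : ∀ a b, G k a * G (k + 1) b = X a b * Y) :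
    (Matrix.of fun (s : Fin (k + 2) → σ) (t : Fin m → σ) =>
        (TensorTrain.uniform L m₀ G α β).eval (fun i => Fin.append s t (i.cast h.symm))).rank ≤ r :=
  TensorTrain.rank_unfolding_uniform_le_of_vecMul_chainProd G α β (k + 2) m h Y
    (fun s => (α ᵥ* TensorTrain.chainProd G k (Fin.init (Fin.init s))) ᵥ*
      X (Fin.init s (Fin.last k)) (s (Fin.last (k + 1)))) fun s => by
      rw [TensorTrain.chainProd, TensorTrain.chainProd, Matrix.mul_assoc, hG, Matrix.vecMul_vecMul,
        Matrix.vecMul_vecMul]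

variable (C : Fin 2 × Fin 2 → Matrix (Fin (n + 1)) (Fin (n + 1)) K) (α β : Fin (n + 1) → K)
  (a : ℕ → K)

/-- THEOREM 4.1 (assembled trains), THE TRIVIAL BOUND: every unfolding matrix of the assembled train
has rank at most the uniform bond dimension `n + 2` (one more than the one-dimensional rank).
[cite: KazeevKhoromskij2012, Thm. 4.1] -/
theorem rank_unfolding_supTrain_le (D d k m : ℕ) (h : k + m = D * d) :
    (Matrix.of fun (s : Fin k → Fin 2 × Fin 2) (t : Fin m → Fin 2 × Fin 2) =>
        (supTrain K C α β a D d).eval (fun i => Fin.append s t (i.cast h.symm))).rank ≤ n + 2 :=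
  TensorTrain.rank_unfolding_le _ k m h

/-- THEOREM 4.1 (assembled trains), THE `2`s: across the bond following the last site of a dimension
(a junction site `ℓ ≡ d - 1 (mod d)`, whose core `diag(C,I) ⋈ B(a_k) ⋈ E` factors through the
rank-2 bond) the unfolding matrix has rank `≤ 2`.  [cite: KazeevKhoromskij2012, Thm. 4.1] -/
theorem rank_unfolding_supTrain_junction_le (D d ℓ m : ℕ) (hℓ : ℓ % d = d - 1)
    (h : ℓ + 1 + m = D * d) :
    (Matrix.of fun (s : Fin (ℓ + 1) → Fin 2 × Fin 2) (t : Fin m → Fin 2 × Fin 2) =>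
        (supTrain K C α β a D d).eval (fun i => Fin.append s t (i.cast h.symm))).rank ≤ 2 :=
  TensorTrain.rank_unfolding_uniform_le_of_core_eq_mul _ _ _ ℓ m h
    (fun p => supCore K C p * supBondR K (a (ℓ / d)) β) (supBondL K α) fun p => by
      show supSite K C α β a d ℓ p = _
      rw [supSite, if_pos hℓ, supJunction]

/-- THEOREM 4.1 (assembled trains), INSIDE THE FIRST SUPERCORE: across the bonds after `k < d` sites
the unfolding matrix has rank `≤ n + 1` — the boundary row `(α, 0)` never excites the identity
channel, so the states live in the one-dimensional channels (the second displays of Cor. 2.4–2.7).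
[cite: KazeevKhoromskij2012, Thm. 4.1] -/
theorem rank_unfolding_supTrain_head_le (D d k m : ℕ) (hk : k < d) (h : k + m = D * d) :
    (Matrix.of fun (s : Fin k → Fin 2 × Fin 2) (t : Fin m → Fin 2 × Fin 2) =>
        (supTrain K C α β a D d).eval (fun i => Fin.append s t (i.cast h.symm))).rank ≤ n + 1 := by
  refine TensorTrain.rank_unfolding_uniform_le_of_vecMul_chainProd _ _ _ k m h (supEmbed K)
    (fun s => α ᵥ* TensorTrain.chainProd (fun _ => C) k s) fun s => ?_
  have hcongr : TensorTrain.chainProd (supSite K C α β a d) k s =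
      TensorTrain.chainProd (fun _ => supCore K C) k s :=
    TensorTrain.chainProd_congr (fun ℓ hℓ p => by
      rw [supSite, Nat.mod_eq_of_lt (by omega), if_neg (by omega)]) s
  rw [hcongr, vecMul_chainProd_supCore, Fin.init_snoc, Fin.snoc_last, zero_mul, vecMul_supEmbed]

/-- THEOREM 4.1 (assembled trains), RIGHT AFTER THE FIRST SITE: if the first row state
`(α, 0) ⋈ diag(C, I)(p)` factors through `r` directions, `= w(p) ⋈ Y`, the unfolding matrix across
the first bond has rank `≤ r` (for `Δ_NN`: `r = 4` through the bond matrix `M` of Lem. 2.2).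
[cite: KazeevKhoromskij2012, Thm. 4.1] -/
theorem rank_unfolding_supTrain_first_le_of (D d m : ℕ) (hd : 1 < d) (h : 1 + m = D * d) {r : ℕ}
    (Y : Matrix (Fin r) (Fin (n + 2)) K) (w : Fin 2 × Fin 2 → Fin r → K)
    (hw : ∀ p, (Fin.snoc α 0 : Fin (n + 2) → K) ᵥ* supCore K C p = w p ᵥ* Y) :
    (Matrix.of fun (s : Fin 1 → Fin 2 × Fin 2) (t : Fin m → Fin 2 × Fin 2) =>
        (supTrain K C α β a D d).eval (fun i => Fin.append s t (i.cast h.symm))).rank ≤ r := by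
  refine TensorTrain.rank_unfolding_uniform_le_of_vecMul_chainProd _ _ _ 1 m h Y
    (fun s => w (s (Fin.last 0))) fun s => ?_
  rw [TensorTrain.chainProd, TensorTrain.chainProd, Matrix.one_mul, supSite, Nat.zero_mod,
    if_neg (by omega)]
  exact hw _

/-- THEOREM 4.1 (assembled trains), RIGHT AFTER THE FIRST SITE OF A LATER DIMENSION: if the first QTT
core of the middle supercore factors as `E ⋈ diag(C, I)(p) = F(p) ⋈ M` through `r` directions, the
unfolding matrix across the bond after the first site of every dimension `k ≥ 1` (the site after a
junction) has rank `≤ r` (for `Δ_NN`: `r = 5`, `M = diag(M, 1)`, the `5` opening the middle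
supercores of Cor. 2.6).  [cite: KazeevKhoromskij2012, Thm. 4.1] -/
theorem rank_unfolding_supTrain_postJunction_le_of (D d ℓ m : ℕ) (hd : 1 < d) (hℓ : ℓ % d = d - 1)
    (h : ℓ + 2 + m = D * d) {r : ℕ} (M : Matrix (Fin r) (Fin (n + 2)) K)
    (F : Fin 2 × Fin 2 → Matrix (Fin 2) (Fin r) K) (hM : ∀ p, supBondL K α * supCore K C p = F p * M) :
    (Matrix.of fun (s : Fin (ℓ + 2) → Fin 2 × Fin 2) (t : Fin m → Fin 2 × Fin 2) =>
        (supTrain K C α β a D d).eval (fun i => Fin.append s t (i.cast h.symm))).rank ≤ r := by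
  have h2 : (ℓ + 1) % d = 0 := by
    rw [Nat.add_mod, hℓ, Nat.mod_eq_of_lt hd, Nat.sub_add_cancel (by omega : 1 ≤ d), Nat.mod_self]
  refine TensorTrain.rank_unfolding_uniform_le_of_mul_core_eq_mul _ _ _ ℓ m h
    (fun p q => supCore K C p * supBondR K (a (ℓ / d)) β * F q) M fun p q => ?_
  show supSite K C α β a d ℓ p * supSite K C α β a d (ℓ + 1) q = _
  rw [supSite, if_pos hℓ, supSite, h2, if_neg (by omega), supJunction, Matrix.mul_assoc _ (supBondL K α),
    hM, ← Matrix.mul_assoc]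

/-- THEOREM 4.1 (assembled trains), RIGHT BEFORE A JUNCTION: if the last QTT core of the middle
supercore factors as `diag(C, I)(p) ⋈ B(c) = Y(c) ⋈ L(c, p)` through `r` directions, the unfolding
matrix across the bond before the last site of every dimension has rank `≤ r` (for `Δ_NN`: `r = 5`
through the `6 × 5` penultimate core of Cor. 2.6).  [cite: KazeevKhoromskij2012, Thm. 4.1] -/
theorem rank_unfolding_supTrain_preJunction_le_of (D d ℓ m : ℕ) (hℓ : ℓ % d = d - 1)
    (h : ℓ + (m + 1) = D * d) {r : ℕ} (Y : K → Matrix (Fin (n + 2)) (Fin r) K)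
    (L : K → Fin 2 × Fin 2 → Matrix (Fin r) (Fin 2) K)
    (hY : ∀ c p, supCore K C p * supBondR K c β = Y c * L c p) :
    (Matrix.of fun (s : Fin ℓ → Fin 2 × Fin 2) (t : Fin (m + 1) → Fin 2 × Fin 2) =>
        (supTrain K C α β a D d).eval (fun i => Fin.append s t (i.cast h.symm))).rank ≤ r := by
  refine TensorTrain.rank_unfolding_uniform_le_of_chainProd_mulVec _ _ _ ℓ (m + 1) h (Y (a (ℓ / d)))
    (fun t => L (a (ℓ / d)) (t 0) *ᵥ (supBondL K α *ᵥ
      (TensorTrain.chainProd (fun i => supSite K C α β a d (ℓ + (i + 1))) m (Fin.tail t) *ᵥ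
        (Fin.snoc 0 1 : Fin (n + 2) → K)))) fun t => ?_
  rw [TensorTrain.chainProd_succ_eq_core_mul, ← Matrix.mulVec_mulVec]
  show supSite K C α β a d ℓ (t 0) *ᵥ _ = _
  rw [supSite, if_pos hℓ, supJunction, ← Matrix.mulVec_mulVec, hY, ← Matrix.mulVec_mulVec]

/-- THEOREM 4.1 (assembled trains), THE VERY LAST BOND: if the column `diag(C, I)(p) ⋈ (cβ; 1)`
entering the last site factors through `r` directions, `= Z(c) ⋈ w(c, p)`, the unfolding matrix
across the last bond has rank `≤ r` (the penultimate cores of the third displays of Cor. 2.4–2.7).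
[cite: KazeevKhoromskij2012, Thm. 4.1] -/
theorem rank_unfolding_supTrain_last_le_of (D d k : ℕ) (h : k + 1 = D * d) {r : ℕ}
    (Z : K → Matrix (Fin (n + 2)) (Fin r) K) (w : K → Fin 2 × Fin 2 → Fin r → K)
    (hZ : ∀ c p, supCore K C p *ᵥ (supBondR K c β *ᵥ ![(0 : K), 1]) = Z c *ᵥ w c p) :
    (Matrix.of fun (s : Fin k → Fin 2 × Fin 2) (t : Fin 1 → Fin 2 × Fin 2) =>
        (supTrain K C α β a D d).eval (fun i => Fin.append s t (i.cast h.symm))).rank ≤ r := by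
  have hd : d ≠ 0 := by
    rintro rfl
    simp at h
  obtain ⟨D', rfl⟩ : ∃ D', D = D' + 1 :=
    Nat.exists_eq_add_one_of_ne_zero (by rintro rfl; simp at h)
  have hk : k = D' * d + (d - 1) := by
    rw [Nat.succ_mul] at h
    omega
  have hkd : k % d = d - 1 := by
    rw [hk, site_mod D' d (d - 1) (by omega)]
  refine TensorTrain.rank_unfolding_uniform_le_of_chainProd_mulVec _ _ _ k 1 h (Z (a (k / d)))
    (fun t => w (a (k / d)) (t (Fin.last 0))) fun t => ?_
  rw [TensorTrain.chainProd, TensorTrain.chainProd, Matrix.one_mul]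
  show supSite K C α β a d k (t (Fin.last 0)) *ᵥ _ = _
  rw [supSite, if_pos hkd, supJunction, ← Matrix.mulVec_mulVec, ← Matrix.mulVec_mulVec,
    supBondL_mulVec, hZ]

end DeviceRanks

/-! ### Corollary 2.5: the supercores with the Dirichlet–Neumann factor `Δ_DN` -/

section MixedBonds

variable (K : Type u) [CommRing K]

/-- The bond matrix `[1 1 0 2c; 1 0 0 0; 0 1 0 0; 0 0 1 0; 0 0 0 1]` (`5 × 4`) through which the
column entering the last site of the assembled `Δ_DN` / `Δ_ND` train factors (rank count `4` at the
last bond, uniform-form device).  [cite: KazeevKhoromskij2012, Thm. 4.1] -/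
def mixedLastZ (c : K) : Matrix (Fin 5) (Fin 4) K :=
  !![1, 1, 0, 2 * c; 1, 0, 0, 0; 0, 1, 0, 0; 0, 0, 1, 0; 0, 0, 0, 1]

variable {K}

/-- THE LEFT BOND MATRIX OF COR. 2.5 WRITTEN OUT: `E = [1 0 0 1 0; 0 0 0 0 1]` for the boundary row
`(1, 0, 0, 1)` of `Δ_DN` / `Δ_ND` (Lem. 2.2).  [cite: KazeevKhoromskij2012, Cor. 2.5] -/
theorem supBondL_mixed : supBondL K ![(1 : K), 0, 0, 1] = !![1, 0, 0, 1, 0; 0, 0, 0, 0, 1] := by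
  ext i j
  fin_cases i <;> fin_cases j <;> simp [supBondL, Fin.snoc]

/-- THE RIGHT BOND MATRIX OF COR. 2.5 WRITTEN OUT: `B(c) = [1 2c; 0 -c; 0 -c; 0 -c; 0 1]` for the
boundary column `(2, -1, -1, -1)` of `Δ_DN` / `Δ_ND`.  [cite: KazeevKhoromskij2012, Cor. 2.5] -/
theorem supBondR_mixed (c : K) :
    supBondR K c ![(2 : K), -1, -1, -1] = !![1, 2 * c; 0, -c; 0, -c; 0, -c; 0, 1] := by
  ext i j
  fin_cases i <;> fin_cases j <;> simp [supBondR, Fin.snoc, mul_comm]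

/-- `B₁(c) = [1 2c; 0 -c; 0 -c; 0 -c]` written out.  [cite: KazeevKhoromskij2012, Cor. 2.5] -/
theorem supBondR₁_mixed (c : K) :
    supBondR₁ K c ![(2 : K), -1, -1, -1] = !![1, 2 * c; 0, -c; 0, -c; 0, -c] := by
  ext i j
  fin_cases i <;> fin_cases j <;> simp [supBondR₁, mul_comm]

end MixedBonds

section MixedBondsField

variable (K : Type u) [Field K]

/-- The bond matrix `Z(c) = [c 0 0 0; 0 c 0 0; 0 0 c 0; 0 0 0 c; ½ -½ -½ 0]` (`5 × 4`) of the terminal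
rank reduction of the last supercore with `Δ_DN` / `Δ_ND`: `penultimate core = diag(C, I) ⋈ Z(c)`
(uniform-form device; requires `½ ∈ K`).  [cite: KazeevKhoromskij2012, Cor. 2.5] -/
def mixedSupZ (c : K) : Matrix (Fin 5) (Fin 4) K :=
  !![c, 0, 0, 0; 0, c, 0, 0; 0, 0, c, 0; 0, 0, 0, c; 2⁻¹, -2⁻¹, -2⁻¹, 0]

end MixedBondsField

section DirichletNeumann

variable (K : Type u) [CommRing K]

/-- THE FIRST QTT CORE `[I J' J I₂ 0; 0 0 0 0 I]` (`2 × 5`, blank = zero block) of the middle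
supercore `[I^{⊗d} a_kΔ_DN^{(d)}; 0 I^{⊗d}]` of Cor. 2.5 (also of its third display and of Cor. 2.6).
[cite: KazeevKhoromskij2012, Cor. 2.5] -/
def dnSupFirst (p : Fin 2 × Fin 2) : Matrix (Fin 2) (Fin 5) K :=
  !![blkI K p, blkJ' K p, blkJ K p, blkI₂ K p, 0; 0, 0, 0, 0, blkI K p]

/-- THE LAST QTT CORE `[I a(2I-J-J'); 0 -aJ; 0 -aJ'; 0 -aI₂; 0 I]` (`5 × 2`) of the middle supercore
of Cor. 2.5 with `Δ_DN`, weight `a = c`.  [cite: KazeevKhoromskij2012, Cor. 2.5] -/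
def dnSupLast (c : K) (p : Fin 2 × Fin 2) : Matrix (Fin 5) (Fin 2) K :=
  !![blkI K p, c * (2 * blkI K p - blkJ K p - blkJ' K p); 0, -c * blkJ K p; 0, -c * blkJ' K p;
    0, -c * blkI₂ K p; 0, blkI K p]

/-- THE LAST QTT CORE `[I a(2I-J-J'); 0 -aJ; 0 -aJ'; 0 -aI₂]` (`4 × 2`) of the first supercore
`[I^{⊗d} a₁Δ_DN^{(d)}]` of Cor. 2.5 (second display).  [cite: KazeevKhoromskij2012, Cor. 2.5] -/
def dnSupLast₁ (c : K) (p : Fin 2 × Fin 2) : Matrix (Fin 4) (Fin 2) K :=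
  !![blkI K p, c * (2 * blkI K p - blkJ K p - blkJ' K p); 0, -c * blkJ K p; 0, -c * blkJ' K p;
    0, -c * blkI₂ K p]

/-- THE LAST QTT CORE `[a(2I-J-J'); -aJ; -aJ'; -aI₂; I]` (`5 × 1`) of the last supercore
`[a_DΔ_DN^{(d)}; I^{⊗d}]` before its rank reduction (first equality in the proof of Cor. 2.5).
[cite: KazeevKhoromskij2012, Cor. 2.5] -/
def dnSupLastCol (c : K) (p : Fin 2 × Fin 2) : Matrix (Fin 5) (Fin 1) K :=
  !![c * (2 * blkI K p - blkJ K p - blkJ' K p); -c * blkJ K p; -c * blkJ' K p; -c * blkI₂ K p;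
    blkI K p]

/-- THE ASSEMBLED QTT TRAIN OF `Σ_k I ⊗ ⋯ ⊗ a_kΔ_DN^{(d)} ⊗ ⋯ ⊗ I` (eq. (3) with Dirichlet–Neumann
factors, all `d_k = d`): the device `supTrain` with the `Δ_DN` data of Lem. 2.2 — cores
`diag(W, I₂, I)`, boundary row `(1, 0, 0, 1)`, boundary column `(2, -1, -1, -1)`.
[cite: KazeevKhoromskij2012, Cor. 2.5] -/
def lapMultiDNTrain (a : ℕ → K) (D d : ℕ) : TensorTrain K (Fin 2 × Fin 2) (D * d) :=
  supTrain K (lapDNCore K) ![1, 0, 0, 1] ![2, -1, -1, -1] a D d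

variable {K}

/-- THE MIDDLE QTT CORE OF COR. 2.5 WRITTEN OUT:
`diag(W, I₂, I) = [I J' J 0 0; 0 J 0 0 0; 0 0 J' 0 0; 0 0 0 I₂ 0; 0 0 0 0 I]` (`5 × 5`).
[cite: KazeevKhoromskij2012, Cor. 2.5] -/
theorem supCore_lapDNCore (p : Fin 2 × Fin 2) :
    supCore K (lapDNCore K) p =
      !![blkI K p, blkJ' K p, blkJ K p, 0, 0; 0, blkJ K p, 0, 0, 0; 0, 0, blkJ' K p, 0, 0;
        0, 0, 0, blkI₂ K p, 0; 0, 0, 0, 0, blkI K p] := by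
  ext i j
  fin_cases i <;> fin_cases j <;> simp [supCore, lapDNCore]

/-- `[I J' J I₂ 0; 0 0 0 0 I] = E ⋈ diag(W, I₂, I)` (bookkeeping).  [cite: KazeevKhoromskij2012, Cor. 2.5] -/
theorem dnSupFirst_eq (p : Fin 2 × Fin 2) :
    dnSupFirst K p = supBondL K ![(1 : K), 0, 0, 1] * supCore K (lapDNCore K) p := by
  rw [supBondL_mixed, supCore_lapDNCore]
  ext i j
  fin_cases i <;> fin_cases j <;> simp [dnSupFirst, Matrix.mul_apply, Fin.sum_univ_five]

/-- `[I a(2I-J-J'); 0 -aJ; 0 -aJ'; 0 -aI₂; 0 I] = diag(W, I₂, I) ⋈ B(a)` (bookkeeping).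
[cite: KazeevKhoromskij2012, Cor. 2.5] -/
theorem dnSupLast_eq (c : K) (p : Fin 2 × Fin 2) :
    dnSupLast K c p = supCore K (lapDNCore K) p * supBondR K c ![(2 : K), -1, -1, -1] := by
  rw [supBondR_mixed, supCore_lapDNCore]
  ext i j
  fin_cases i <;> fin_cases j <;> simp [dnSupLast, Matrix.mul_apply, Fin.sum_univ_five, mul_comm]
  ring

/-- `[I a(2I-J-J'); 0 -aJ; 0 -aJ'; 0 -aI₂] = diag(W, I₂) ⋈ B₁(a)` (bookkeeping).
[cite: KazeevKhoromskij2012, Cor. 2.5] -/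
theorem dnSupLast₁_eq (c : K) (p : Fin 2 × Fin 2) :
    dnSupLast₁ K c p = lapDNCore K p * supBondR₁ K c ![(2 : K), -1, -1, -1] := by
  rw [supBondR₁_mixed]
  ext i j
  fin_cases i <;> fin_cases j <;>
    simp [dnSupLast₁, lapDNCore, Matrix.mul_apply, Fin.sum_univ_four, mul_comm]
  ring

/-- `[a(2I-J-J'); -aJ; -aJ'; -aI₂; I] = diag(W, I₂, I) ⋈ (B(a) ⋈ (0, 1)ᵀ)` (bookkeeping).
[cite: KazeevKhoromskij2012, Cor. 2.5] -/
theorem dnSupLastCol_eq (c : K) (p : Fin 2 × Fin 2) :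
    dnSupLastCol K c p = Matrix.of fun i (_ : Fin 1) =>
      (supCore K (lapDNCore K) p *ᵥ (supBondR K c ![(2 : K), -1, -1, -1] *ᵥ ![(0 : K), 1])) i := by
  rw [supBondR_mixed, supCore_lapDNCore]
  ext i j
  fin_cases i <;> fin_cases j <;>
    simp [dnSupLastCol, Matrix.mulVec, dotProduct, Fin.sum_univ_five, Fin.sum_univ_two, mul_comm]
  ring

/-- THE JUNCTION CORE OF THE ASSEMBLED `Δ_DN` TRAIN WRITTEN OUT:
`diag(W, I₂, I) ⋈ B(a) ⋈ E = [I 0 0 I a(2I-J-J'); 0 0 0 0 -aJ; 0 0 0 0 -aJ'; 0 0 0 0 -aI₂; 0 0 0 0 I]`.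
[cite: KazeevKhoromskij2012, Cor. 2.5] -/
theorem dnSupJunction_eq (c : K) (p : Fin 2 × Fin 2) :
    supJunction K (lapDNCore K) ![(1 : K), 0, 0, 1] ![2, -1, -1, -1] c p =
      !![blkI K p, 0, 0, blkI K p, c * (2 * blkI K p - blkJ K p - blkJ' K p);
        0, 0, 0, 0, -c * blkJ K p; 0, 0, 0, 0, -c * blkJ' K p; 0, 0, 0, 0, -c * blkI₂ K p;
        0, 0, 0, 0, blkI K p] := by
  rw [supJunction, ← dnSupLast_eq, supBondL_mixed]
  ext i j
  fin_cases i <;> fin_cases j <;> simp [dnSupLast, Matrix.mul_apply, Fin.sum_univ_two]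

/-- CHANNEL `0` OF THE `Δ_DN` AUTOMATON IS THE DIAGONAL INDICATOR: after `d` digit pairs the state
`(1,0,0,1) · diag(W,I₂)(i₁,j₁) ⋯ diag(W,I₂)(i_d,j_d)` has `𝟙[m = n]` in channel `0` (Lem. 2.1/2.2).
[cite: KazeevKhoromskij2012, Lem. 2.2] -/
theorem vecMul_chainProd_lapDNCore_zero (d : ℕ) (σ μ : Fin d → Fin 2) :
    (![(1 : K), 0, 0, 1] ᵥ* TensorTrain.chainProd (fun _ => lapDNCore K) d (fun r => (σ r, μ r))) 0 =
      (1 : Matrix (Fin (2 ^ d)) (Fin (2 ^ d)) K) (quanticsEquiv 2 d σ) (quanticsEquiv 2 d μ) := by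
  rw [vecMul_chainProd_lapDNCore, Matrix.one_apply]
  simp [lapDNVec, Fin.val_inj]

/-- THE `Δ_DN` AUTOMATON CLOSED BY ITS BOUNDARY COLUMN gives `Δ_DN^{(d)}(m, n)` (Lem. 2.2 in row form).
[cite: KazeevKhoromskij2012, Lem. 2.2] -/
theorem vecMul_chainProd_lapDNCore_dotProduct (d : ℕ) (σ μ : Fin d → Fin 2) :
    ![(1 : K), 0, 0, 1] ᵥ* TensorTrain.chainProd (fun _ => lapDNCore K) d (fun r => (σ r, μ r)) ⬝ᵥ
        ![2, -1, -1, -1] =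
      laplaceDN K (2 ^ d) (quanticsEquiv 2 d σ) (quanticsEquiv 2 d μ) := by
  rw [← eval_lapDNTrain, lapDNTrain, TensorTrain.eval_uniform]

/-- THE MIDDLE SUPERCORE IDENTITY WITH `Δ_DN` (uniform form, every `d ≥ 0`):
`E · diag(W,I₂,I)(i₁,j₁) ⋯ diag(W,I₂,I)(i_d,j_d) · B(c) = [𝟙[m=n] cΔ_DN^{(d)}(m,n); 0 𝟙[m=n]]`, the
block entry of `[I^{⊗d} cΔ_DN^{(d)}; 0 I^{⊗d}]`.  [cite: KazeevKhoromskij2012, Cor. 2.5] -/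
theorem supBondL_mul_chainProd_mul_supBondR_dn (c : K) (d : ℕ) (σ μ : Fin d → Fin 2) :
    supBondL K ![(1 : K), 0, 0, 1] *
        TensorTrain.chainProd (fun _ => supCore K (lapDNCore K)) d (fun r => (σ r, μ r)) *
        supBondR K c ![2, -1, -1, -1] =
      laplaceMultiCore c (laplaceDN K (2 ^ d)) (quanticsEquiv 2 d σ, quanticsEquiv 2 d μ) :=
  supBondL_mul_chainProd_mul_supBondR _ _ _ _ c σ μ (vecMul_chainProd_lapDNCore_zero d σ μ)
    (vecMul_chainProd_lapDNCore_dotProduct d σ μ)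

/-- COROLLARY 2.5, MIDDLE SUPERCORE, VERBATIM (`d = k + 2 ≥ 2`): the `((i₁…i_d), (j₁…j_d))` block
entry of `[I J' J I₂ 0; 0 0 0 0 I] ⋈ [I J' J 0 0; 0 J 0 0 0; 0 0 J' 0 0; 0 0 0 I₂ 0; 0 0 0 0 I]^{⋈(d-2)}
⋈ [I a(2I-J-J'); 0 -aJ; 0 -aJ'; 0 -aI₂; 0 I]`, i.e. the `2 × 2` matrix
`dnSupFirst(i₁,j₁) · diag(W,I₂,I)(i₂,j₂) ⋯ diag(W,I₂,I)(i_{d-1},j_{d-1}) · dnSupLast a (i_d,j_d)`, is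
`[𝟙[m=n] aΔ_DN^{(d)}(m,n); 0 𝟙[m=n]]` — the block entry of the supercore `[I^{⊗d} a_kΔ_DN^{(d)}; 0 I^{⊗d}]`,
a rank-`5 ⋯ 5` QTT representation (the paper states it for `d ≥ 3`).
[cite: KazeevKhoromskij2012, Cor. 2.5] -/
theorem dnSupFirst_mul_chainProd_mul_dnSupLast (c : K) (k : ℕ) (σ μ : Fin (k + 2) → Fin 2) :
    dnSupFirst K (σ 0, μ 0) *
        TensorTrain.chainProd (fun _ => supCore K (lapDNCore K)) k
          (fun r : Fin k => (σ r.succ.castSucc, μ r.succ.castSucc)) *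
        dnSupLast K c (σ (Fin.last (k + 1)), μ (Fin.last (k + 1))) =
      laplaceMultiCore c (laplaceDN K (2 ^ (k + 2)))
        (quanticsEquiv 2 (k + 2) σ, quanticsEquiv 2 (k + 2) μ) := by
  rw [← supBondL_mul_chainProd_mul_supBondR_dn c (k + 2) σ μ, TensorTrain.chainProd,
    TensorTrain.chainProd_succ_eq_mul, dnSupFirst_eq, dnSupLast_eq]
  simp only [Matrix.mul_assoc]
  rfl

/-- [folklore] `[I J' J I₂] = (1,0,0,1) ⋈ diag(W, I₂)` as a row matrix (bookkeeping). -/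
private theorem dnFirst_eq_of (p : Fin 2 × Fin 2) :
    dnFirst K p = Matrix.of fun (_ : Fin 1) j => (![(1 : K), 0, 0, 1] ᵥ* lapDNCore K p) j := by
  ext i j
  fin_cases i; fin_cases j <;>
    simp [dnFirst, lapDNCore, Matrix.vecMul, dotProduct, Fin.sum_univ_four]

/-- [folklore] `[2I-J-J'; -J; -J'; -I₂] = diag(W, I₂) ⋈ (2,-1,-1,-1)ᵀ` as a column matrix
(bookkeeping). -/
private theorem dnLast_eq_of (p : Fin 2 × Fin 2) :
    dnLast K p = Matrix.of fun i (_ : Fin 1) => (lapDNCore K p *ᵥ ![(2 : K), -1, -1, -1]) i := by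
  ext i j
  fin_cases j; fin_cases i <;>
    simp [dnLast, lapDNCore, Matrix.mulVec, dotProduct, Fin.sum_univ_four]
  ring

/-- COROLLARY 2.5, FIRST SUPERCORE, VERBATIM (`d = k + 2 ≥ 2`): the block entry of
`[I J' J I₂] ⋈ [I J' J 0; 0 J 0 0; 0 0 J' 0; 0 0 0 I₂]^{⋈(d-2)} ⋈ [I a(2I-J-J'); 0 -aJ; 0 -aJ'; 0 -aI₂]`
is `[𝟙[m=n] aΔ_DN^{(d)}(m,n)]`, the block entry of the first supercore `[I^{⊗d} a₁Δ_DN^{(d)}]` — a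
rank-`4 ⋯ 4` QTT representation.  [cite: KazeevKhoromskij2012, Cor. 2.5] -/
theorem dnFirst_mul_chainProd_mul_dnSupLast₁ (c : K) (k : ℕ) (σ μ : Fin (k + 2) → Fin 2) :
    dnFirst K (σ 0, μ 0) *
        TensorTrain.chainProd (fun _ => lapDNCore K) k
          (fun r : Fin k => (σ r.succ.castSucc, μ r.succ.castSucc)) *
        dnSupLast₁ K c (σ (Fin.last (k + 1)), μ (Fin.last (k + 1))) =
      !![(1 : Matrix (Fin (2 ^ (k + 2))) (Fin (2 ^ (k + 2))) K)
          (quanticsEquiv 2 (k + 2) σ) (quanticsEquiv 2 (k + 2) μ),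
        c * laplaceDN K (2 ^ (k + 2)) (quanticsEquiv 2 (k + 2) σ) (quanticsEquiv 2 (k + 2) μ)] := by
  have key : (![(1 : K), 0, 0, 1] ᵥ*
        TensorTrain.chainProd (fun _ => lapDNCore K) (k + 2) (fun r => (σ r, μ r))) ᵥ*
        supBondR₁ K c ![(2 : K), -1, -1, -1] =
      ((![(1 : K), 0, 0, 1] ᵥ* lapDNCore K (σ 0, μ 0)) ᵥ*
        TensorTrain.chainProd (fun _ => lapDNCore K) k
          (fun r : Fin k => (σ r.succ.castSucc, μ r.succ.castSucc))) ᵥ*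
        (lapDNCore K (σ (Fin.last (k + 1)), μ (Fin.last (k + 1))) *
          supBondR₁ K c ![(2 : K), -1, -1, -1]) := by
    rw [TensorTrain.chainProd, TensorTrain.chainProd_succ_eq_mul]
    simp only [Matrix.vecMul_vecMul, Matrix.mul_assoc]
    rfl
  ext i j
  fin_cases i
  rw [dnFirst_eq_of, dnSupLast₁_eq, of_row_mul, of_row_mul, Matrix.of_apply, ← key,
    vecMul_chainProd_vecMul_supBondR₁ (lapDNCore K) _ _ (laplaceDN K (2 ^ (k + 2))) c σ μ
      (vecMul_chainProd_lapDNCore_zero (k + 2) σ μ)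
      (vecMul_chainProd_lapDNCore_dotProduct (k + 2) σ μ)]
  fin_cases j <;> simp

/-- COROLLARY 2.5, LAST SUPERCORE BEFORE REDUCTION (first equality of its proof; `d = k + 2 ≥ 2`):
the block entry of `[I J' J I₂ 0; 0 0 0 0 I] ⋈ diag(W, I₂, I)^{⋈(d-2)} ⋈ [a(2I-J-J'); -aJ; -aJ'; -aI₂; I]`
is the column `[aΔ_DN^{(d)}(m,n); 𝟙[m=n]]`, the block entry of the last supercore
`[a_DΔ_DN^{(d)}; I^{⊗d}]` — rank `5 ⋯ 5` before the terminal reduction.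
[cite: KazeevKhoromskij2012, Cor. 2.5] -/
theorem dnSupFirst_mul_chainProd_mul_dnSupLastCol (c : K) (k : ℕ) (σ μ : Fin (k + 2) → Fin 2) :
    dnSupFirst K (σ 0, μ 0) *
        TensorTrain.chainProd (fun _ => supCore K (lapDNCore K)) k
          (fun r : Fin k => (σ r.succ.castSucc, μ r.succ.castSucc)) *
        dnSupLastCol K c (σ (Fin.last (k + 1)), μ (Fin.last (k + 1))) =
      !![c * laplaceDN K (2 ^ (k + 2)) (quanticsEquiv 2 (k + 2) σ) (quanticsEquiv 2 (k + 2) μ);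
        (1 : Matrix (Fin (2 ^ (k + 2))) (Fin (2 ^ (k + 2))) K)
          (quanticsEquiv 2 (k + 2) σ) (quanticsEquiv 2 (k + 2) μ)] := by
  have hchain : supCore K (lapDNCore K) (σ 0, μ 0) *
        TensorTrain.chainProd (fun _ => supCore K (lapDNCore K)) k
          (fun r : Fin k => (σ r.succ.castSucc, μ r.succ.castSucc)) *
        supCore K (lapDNCore K) (σ (Fin.last (k + 1)), μ (Fin.last (k + 1))) =
      TensorTrain.chainProd (fun _ => supCore K (lapDNCore K)) (k + 2) (fun r => (σ r, μ r)) := by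
    rw [TensorTrain.chainProd, TensorTrain.chainProd_succ_eq_mul]
    rfl
  rw [← supBondL_mul_chainProd_mul_col (lapDNCore K) _ _ (laplaceDN K (2 ^ (k + 2))) c σ μ
      (vecMul_chainProd_lapDNCore_zero (k + 2) σ μ) (vecMul_chainProd_lapDNCore_dotProduct (k + 2) σ μ),
    ← hchain, dnSupFirst_eq, dnSupLastCol_eq]
  simp only [Matrix.mul_assoc, mul_of_col]

/-- COROLLARY 2.3 WITH THE SUPERCORES OF COR. 2.5 SUBSTITUTED (Rem. 1.2): for `d ≥ 1` the assembled
`Δ_DN` train evaluates, at the bit-pair string `(τ_ℓ, τ'_ℓ)`, to the entry of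
`Σ_k I ⊗ ⋯ ⊗ a_kΔ_DN^{(d)} ⊗ ⋯ ⊗ I` at the serialised multi-indices.
[cite: KazeevKhoromskij2012, Cor. 2.5] -/
theorem eval_lapMultiDNTrain (a : ℕ → K) (D d : ℕ) (hd : 0 < d) (τ τ' : Fin (D * d) → Fin 2) :
    (lapMultiDNTrain K a D d).eval (fun ℓ => (τ ℓ, τ' ℓ)) =
      laplaceMulti (fun k : Fin D => a k) (fun _ => laplaceDN K (2 ^ d)) (serialEquiv 2 D d τ)
        (serialEquiv 2 D d τ') :=
  eval_supTrain (lapDNCore K) _ _ a D d hd (laplaceDN K (2 ^ d)) (vecMul_chainProd_lapDNCore_zero d)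
    (vecMul_chainProd_lapDNCore_dotProduct d) τ τ'

/-- THE QTT DECOMPOSITION OF THE `D`-DIMENSIONAL DIRICHLET–NEUMANN LAPLACE OPERATOR (Cor. 2.3 +
Cor. 2.5, uniform grids `2^d × ⋯ × 2^d`): the TT matrix of the assembled train is
`Σ_k I ⊗ ⋯ ⊗ a_kΔ_DN^{(2^d)} ⊗ ⋯ ⊗ I` with its multi-indices serialised dimension by dimension.
[cite: KazeevKhoromskij2012, Cor. 2.5] -/
theorem ttMatrix_lapMultiDNTrain (a : ℕ → K) (D d : ℕ) (hd : 0 < d) :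
    (lapMultiDNTrain K a D d).ttMatrix =
      (laplaceMulti (fun k : Fin D => a k) (fun _ => laplaceDN K (2 ^ d))).submatrix
        (serialEquiv 2 D d) (serialEquiv 2 D d) :=
  ttMatrix_supTrain (lapDNCore K) _ _ a D d hd (laplaceDN K (2 ^ d))
    (vecMul_chainProd_lapDNCore_zero d) (vecMul_chainProd_lapDNCore_dotProduct d)

end DirichletNeumann

section DirichletNeumannReduced

variable (K : Type u) [Field K]

/-- THE PENULTIMATE QTT CORE `[aI aJ' aJ 0; 0 aJ 0 0; 0 0 aJ' 0; 0 0 0 aI₂; ½I -½I -½I 0]` (`5 × 4`)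
of the reduced last supercore `[a_DΔ_DN^{(d)}; I^{⊗d}]` of Cor. 2.5 (third display).
[cite: KazeevKhoromskij2012, Cor. 2.5] -/
def dnSupPenult (c : K) (p : Fin 2 × Fin 2) : Matrix (Fin 5) (Fin 4) K :=
  !![c * blkI K p, c * blkJ' K p, c * blkJ K p, 0; 0, c * blkJ K p, 0, 0; 0, 0, c * blkJ' K p, 0;
    0, 0, 0, c * blkI₂ K p; 2⁻¹ * blkI K p, -2⁻¹ * blkI K p, -2⁻¹ * blkI K p, 0]

variable {K}

/-- `dnSupPenult c = diag(W, I₂, I) ⋈ Z(c)` (bookkeeping).  [cite: KazeevKhoromskij2012, Cor. 2.5] -/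
theorem dnSupPenult_eq (c : K) (p : Fin 2 × Fin 2) :
    dnSupPenult K c p = supCore K (lapDNCore K) p * mixedSupZ K c := by
  rw [supCore_lapDNCore]
  ext i j
  fin_cases i <;> fin_cases j <;>
    simp [dnSupPenult, mixedSupZ, Matrix.mul_apply, Fin.sum_univ_five, mul_comm]

/-- THE SWEEP OF COR. 2.5's THIRD DISPLAY (where `½` enters): for every digit pair,
`Z(c) · (diag(W,I₂) ⋈ (2,-1,-1,-1)ᵀ) = diag(W,I₂,I) · (B(c) ⋈ (0,1)ᵀ)`, i.e.
`Z(c)·[2I-J-J'; -J; -J'; -I₂] = [c(2I-J-J'); -cJ; -cJ'; -cI₂; I]`; the last row is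
`½(2I-J-J') + ½J + ½J' = I`.  Requires `2 ≠ 0` in `K`.  [cite: KazeevKhoromskij2012, Cor. 2.5] -/
theorem mixedSupZ_mulVec_lapDNCore_mulVec [NeZero (2 : K)] (c : K) (p : Fin 2 × Fin 2) :
    mixedSupZ K c *ᵥ (lapDNCore K p *ᵥ ![2, -1, -1, -1]) =
      supCore K (lapDNCore K) p *ᵥ (supBondR K c ![(2 : K), -1, -1, -1] *ᵥ ![(0 : K), 1]) := by
  rw [supCore_lapDNCore, supBondR_mixed]
  obtain ⟨a, a'⟩ := p
  ext j
  fin_cases a <;> fin_cases a' <;> fin_cases j <;>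
    simp [mixedSupZ, lapDNCore, blkI, blkJ, blkJ', blkI₂, Matrix.mulVec, dotProduct,
      Fin.sum_univ_two, Fin.sum_univ_four, Fin.sum_univ_five] <;>
    first | ring1 | exact inv_mul_cancel₀ two_ne_zero

/-- COROLLARY 2.5, LAST SUPERCORE, VERBATIM (`d = k + 3 ≥ 3`, `2 ≠ 0` in `K`): the block entry of
`[I J' J I₂ 0; 0 0 0 0 I] ⋈ [I J' J 0 0; 0 J 0 0 0; 0 0 J' 0 0; 0 0 0 I₂ 0; 0 0 0 0 I]^{⋈(d-3)}
   ⋈ [aI aJ' aJ 0; 0 aJ 0 0; 0 0 aJ' 0; 0 0 0 aI₂; ½I -½I -½I 0] ⋈ [2I-J-J'; -J; -J'; -I₂]`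
is `[aΔ_DN^{(d)}(m,n); 𝟙[m=n]]`, the block entry of the last supercore `[a_DΔ_DN^{(d)}; I^{⊗d}]` —
a rank-`5 ⋯ 5, 4` QTT representation.  [cite: KazeevKhoromskij2012, Cor. 2.5] -/
theorem dnSupFirst_mul_chainProd_mul_dnSupPenult_mul_dnLast [NeZero (2 : K)] (c : K) (k : ℕ)
    (σ μ : Fin (k + 3) → Fin 2) :
    dnSupFirst K (σ 0, μ 0) *
          TensorTrain.chainProd (fun _ => supCore K (lapDNCore K)) k
            (fun r : Fin k => (σ r.succ.castSucc.castSucc, μ r.succ.castSucc.castSucc)) *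
        dnSupPenult K c (σ (Fin.last (k + 1)).castSucc, μ (Fin.last (k + 1)).castSucc) *
        dnLast K (σ (Fin.last (k + 2)), μ (Fin.last (k + 2))) =
      !![c * laplaceDN K (2 ^ (k + 3)) (quanticsEquiv 2 (k + 3) σ) (quanticsEquiv 2 (k + 3) μ);
        (1 : Matrix (Fin (2 ^ (k + 3))) (Fin (2 ^ (k + 3))) K)
          (quanticsEquiv 2 (k + 3) σ) (quanticsEquiv 2 (k + 3) μ)] := by
  have hchain : supCore K (lapDNCore K) (σ 0, μ 0) *
        TensorTrain.chainProd (fun _ => supCore K (lapDNCore K)) k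
          (fun r : Fin k => (σ r.succ.castSucc.castSucc, μ r.succ.castSucc.castSucc)) *
        supCore K (lapDNCore K) (σ (Fin.last (k + 1)).castSucc, μ (Fin.last (k + 1)).castSucc) *
        supCore K (lapDNCore K) (σ (Fin.last (k + 2)), μ (Fin.last (k + 2))) =
      TensorTrain.chainProd (fun _ => supCore K (lapDNCore K)) (k + 3) (fun r => (σ r, μ r)) := by
    rw [TensorTrain.chainProd, TensorTrain.chainProd, TensorTrain.chainProd_succ_eq_mul]
    rfl
  rw [← supBondL_mul_chainProd_mul_col (lapDNCore K) _ _ (laplaceDN K (2 ^ (k + 3))) c σ μ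
      (vecMul_chainProd_lapDNCore_zero (k + 3) σ μ) (vecMul_chainProd_lapDNCore_dotProduct (k + 3) σ μ),
    ← hchain, dnSupFirst_eq, dnSupPenult_eq, dnLast_eq_of]
  simp only [Matrix.mul_assoc, mul_of_col, mixedSupZ_mulVec_lapDNCore_mulVec]

end DirichletNeumannReduced

section DirichletNeumannRanks

variable {K : Type u} [Field K]

/-- THEOREM 4.1 FOR `Δ_DN^{(d…d)}`, THE `5`s: every unfolding matrix of the assembled train has rank
`≤ 5` (line `4…4, 2, 5…5, 2, …, 2, 5…5, 4`).  [cite: KazeevKhoromskij2012, Thm. 4.1] -/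
theorem rank_unfolding_lapMultiDNTrain_le (a : ℕ → K) (D d k m : ℕ) (h : k + m = D * d) :
    (Matrix.of fun (s : Fin k → Fin 2 × Fin 2) (t : Fin m → Fin 2 × Fin 2) =>
        (lapMultiDNTrain K a D d).eval (fun i => Fin.append s t (i.cast h.symm))).rank ≤ 5 :=
  rank_unfolding_supTrain_le (lapDNCore K) _ _ a D d k m h

/-- THEOREM 4.1 FOR `Δ_DN^{(d…d)}`, THE `2`s: across the bond after the last site of each dimension
the unfolding rank is `≤ 2`.  [cite: KazeevKhoromskij2012, Thm. 4.1] -/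
theorem rank_unfolding_lapMultiDNTrain_junction_le (a : ℕ → K) (D d ℓ m : ℕ) (hℓ : ℓ % d = d - 1)
    (h : ℓ + 1 + m = D * d) :
    (Matrix.of fun (s : Fin (ℓ + 1) → Fin 2 × Fin 2) (t : Fin m → Fin 2 × Fin 2) =>
        (lapMultiDNTrain K a D d).eval (fun i => Fin.append s t (i.cast h.symm))).rank ≤ 2 :=
  rank_unfolding_supTrain_junction_le (lapDNCore K) _ _ a D d ℓ m hℓ h

/-- THEOREM 4.1 FOR `Δ_DN^{(d…d)}`, THE LEADING `4…4`: inside the first supercore (after `k < d`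
sites) the unfolding rank is `≤ 4`.  [cite: KazeevKhoromskij2012, Thm. 4.1] -/
theorem rank_unfolding_lapMultiDNTrain_head_le (a : ℕ → K) (D d k m : ℕ) (hk : k < d)
    (h : k + m = D * d) :
    (Matrix.of fun (s : Fin k → Fin 2 × Fin 2) (t : Fin m → Fin 2 × Fin 2) =>
        (lapMultiDNTrain K a D d).eval (fun i => Fin.append s t (i.cast h.symm))).rank ≤ 4 :=
  rank_unfolding_supTrain_head_le (lapDNCore K) _ _ a D d k m hk h

/-- [folklore] The column entering the last site factors through `mixedLastZ` (bookkeeping case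
analysis): `diag(W,I₂,I)(p) · (2c,-c,-c,-c,1)ᵀ = mixedLastZ(c) · (-cJ, -cJ', -cI₂, I)(p)`. -/
private theorem supCore_lapDNCore_mulVec (c : K) (p : Fin 2 × Fin 2) :
    supCore K (lapDNCore K) p *ᵥ (supBondR K c ![(2 : K), -1, -1, -1] *ᵥ ![(0 : K), 1]) =
      mixedLastZ K c *ᵥ ![-c * blkJ K p, -c * blkJ' K p, -c * blkI₂ K p, blkI K p] := by
  rw [supCore_lapDNCore, supBondR_mixed]
  ext j
  fin_cases j <;>
    simp [mixedLastZ, Matrix.mulVec, dotProduct, Fin.sum_univ_two, Fin.sum_univ_four,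
      Fin.sum_univ_five] <;> ring

/-- THEOREM 4.1 FOR `Δ_DN^{(d…d)}`, THE TRAILING `4`: across the very last bond the unfolding rank is
`≤ 4` (the `5 × 4` penultimate core of Cor. 2.5's third display).
[cite: KazeevKhoromskij2012, Thm. 4.1] -/
theorem rank_unfolding_lapMultiDNTrain_last_le (a : ℕ → K) (D d k : ℕ) (h : k + 1 = D * d) :
    (Matrix.of fun (s : Fin k → Fin 2 × Fin 2) (t : Fin 1 → Fin 2 × Fin 2) =>
        (lapMultiDNTrain K a D d).eval (fun i => Fin.append s t (i.cast h.symm))).rank ≤ 4 :=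
  rank_unfolding_supTrain_last_le_of (lapDNCore K) _ _ a D d k h (fun c => mixedLastZ K c)
    (fun c p => ![-c * blkJ K p, -c * blkJ' K p, -c * blkI₂ K p, blkI K p])
    (supCore_lapDNCore_mulVec)

end DirichletNeumannRanks

/-! ### Corollary 2.5, last sentence: the same supercores with the Neumann–Dirichlet factor `Δ_ND`
("the same representations … `I₂` being replaced with `I₁`") -/

section NeumannDirichlet

variable (K : Type u) [CommRing K]

/-- THE FIRST QTT CORE `[I J' J I₁ 0; 0 0 0 0 I]` (`2 × 5`, blank = zero block) of the middle
supercore `[I^{⊗d} a_kΔ_ND^{(d)}; 0 I^{⊗d}]` of Cor. 2.5 (the `Δ_DN` cores with `I₁` in place of `I₂`,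
last sentence of the corollary).  [cite: KazeevKhoromskij2012, Cor. 2.5] -/
def ndSupFirst (p : Fin 2 × Fin 2) : Matrix (Fin 2) (Fin 5) K :=
  !![blkI K p, blkJ' K p, blkJ K p, blkI₁ K p, 0; 0, 0, 0, 0, blkI K p]

/-- THE LAST QTT CORE `[I a(2I-J-J'); 0 -aJ; 0 -aJ'; 0 -aI₁; 0 I]` (`5 × 2`) of the middle supercore
of Cor. 2.5 with `Δ_ND`, weight `a = c`.  [cite: KazeevKhoromskij2012, Cor. 2.5] -/
def ndSupLast (c : K) (p : Fin 2 × Fin 2) : Matrix (Fin 5) (Fin 2) K :=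
  !![blkI K p, c * (2 * blkI K p - blkJ K p - blkJ' K p); 0, -c * blkJ K p; 0, -c * blkJ' K p;
    0, -c * blkI₁ K p; 0, blkI K p]

/-- THE LAST QTT CORE `[I a(2I-J-J'); 0 -aJ; 0 -aJ'; 0 -aI₁]` (`4 × 2`) of the first supercore
`[I^{⊗d} a₁Δ_ND^{(d)}]` of Cor. 2.5 (second display).  [cite: KazeevKhoromskij2012, Cor. 2.5] -/
def ndSupLast₁ (c : K) (p : Fin 2 × Fin 2) : Matrix (Fin 4) (Fin 2) K :=
  !![blkI K p, c * (2 * blkI K p - blkJ K p - blkJ' K p); 0, -c * blkJ K p; 0, -c * blkJ' K p;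
    0, -c * blkI₁ K p]

/-- THE LAST QTT CORE `[a(2I-J-J'); -aJ; -aJ'; -aI₁; I]` (`5 × 1`) of the last supercore
`[a_DΔ_ND^{(d)}; I^{⊗d}]` before its rank reduction (first equality in the proof of Cor. 2.5).
[cite: KazeevKhoromskij2012, Cor. 2.5] -/
def ndSupLastCol (c : K) (p : Fin 2 × Fin 2) : Matrix (Fin 5) (Fin 1) K :=
  !![c * (2 * blkI K p - blkJ K p - blkJ' K p); -c * blkJ K p; -c * blkJ' K p; -c * blkI₁ K p;
    blkI K p]

/-- THE ASSEMBLED QTT TRAIN OF `Σ_k I ⊗ ⋯ ⊗ a_kΔ_ND^{(d)} ⊗ ⋯ ⊗ I` (eq. (3) with Neumann–Dirichlet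
factors, all `d_k = d`): the device `supTrain` with the `Δ_ND` data of Lem. 2.2 — cores
`diag(W, I₁, I)`, boundary row `(1, 0, 0, 1)`, boundary column `(2, -1, -1, -1)`.
[cite: KazeevKhoromskij2012, Cor. 2.5] -/
def lapMultiNDTrain (a : ℕ → K) (D d : ℕ) : TensorTrain K (Fin 2 × Fin 2) (D * d) :=
  supTrain K (lapNDCore K) ![1, 0, 0, 1] ![2, -1, -1, -1] a D d

variable {K}

/-- THE MIDDLE QTT CORE OF COR. 2.5 WRITTEN OUT:
`diag(W, I₁, I) = [I J' J 0 0; 0 J 0 0 0; 0 0 J' 0 0; 0 0 0 I₁ 0; 0 0 0 0 I]` (`5 × 5`).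
[cite: KazeevKhoromskij2012, Cor. 2.5] -/
theorem supCore_lapNDCore (p : Fin 2 × Fin 2) :
    supCore K (lapNDCore K) p =
      !![blkI K p, blkJ' K p, blkJ K p, 0, 0; 0, blkJ K p, 0, 0, 0; 0, 0, blkJ' K p, 0, 0;
        0, 0, 0, blkI₁ K p, 0; 0, 0, 0, 0, blkI K p] := by
  ext i j
  fin_cases i <;> fin_cases j <;> simp [supCore, lapNDCore]

/-- `[I J' J I₁ 0; 0 0 0 0 I] = E ⋈ diag(W, I₁, I)` (bookkeeping).  [cite: KazeevKhoromskij2012, Cor. 2.5] -/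
theorem ndSupFirst_eq (p : Fin 2 × Fin 2) :
    ndSupFirst K p = supBondL K ![(1 : K), 0, 0, 1] * supCore K (lapNDCore K) p := by
  rw [supBondL_mixed, supCore_lapNDCore]
  ext i j
  fin_cases i <;> fin_cases j <;> simp [ndSupFirst, Matrix.mul_apply, Fin.sum_univ_five]

/-- `[I a(2I-J-J'); 0 -aJ; 0 -aJ'; 0 -aI₁; 0 I] = diag(W, I₁, I) ⋈ B(a)` (bookkeeping).
[cite: KazeevKhoromskij2012, Cor. 2.5] -/
theorem ndSupLast_eq (c : K) (p : Fin 2 × Fin 2) :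
    ndSupLast K c p = supCore K (lapNDCore K) p * supBondR K c ![(2 : K), -1, -1, -1] := by
  rw [supBondR_mixed, supCore_lapNDCore]
  ext i j
  fin_cases i <;> fin_cases j <;> simp [ndSupLast, Matrix.mul_apply, Fin.sum_univ_five, mul_comm]
  ring

/-- `[I a(2I-J-J'); 0 -aJ; 0 -aJ'; 0 -aI₁] = diag(W, I₁) ⋈ B₁(a)` (bookkeeping).
[cite: KazeevKhoromskij2012, Cor. 2.5] -/
theorem ndSupLast₁_eq (c : K) (p : Fin 2 × Fin 2) :
    ndSupLast₁ K c p = lapNDCore K p * supBondR₁ K c ![(2 : K), -1, -1, -1] := by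
  rw [supBondR₁_mixed]
  ext i j
  fin_cases i <;> fin_cases j <;>
    simp [ndSupLast₁, lapNDCore, Matrix.mul_apply, Fin.sum_univ_four, mul_comm]
  ring

/-- `[a(2I-J-J'); -aJ; -aJ'; -aI₁; I] = diag(W, I₁, I) ⋈ (B(a) ⋈ (0, 1)ᵀ)` (bookkeeping).
[cite: KazeevKhoromskij2012, Cor. 2.5] -/
theorem ndSupLastCol_eq (c : K) (p : Fin 2 × Fin 2) :
    ndSupLastCol K c p = Matrix.of fun i (_ : Fin 1) =>
      (supCore K (lapNDCore K) p *ᵥ (supBondR K c ![(2 : K), -1, -1, -1] *ᵥ ![(0 : K), 1])) i := by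
  rw [supBondR_mixed, supCore_lapNDCore]
  ext i j
  fin_cases i <;> fin_cases j <;>
    simp [ndSupLastCol, Matrix.mulVec, dotProduct, Fin.sum_univ_five, Fin.sum_univ_two, mul_comm]
  ring

/-- THE JUNCTION CORE OF THE ASSEMBLED `Δ_ND` TRAIN WRITTEN OUT:
`diag(W, I₁, I) ⋈ B(a) ⋈ E = [I 0 0 I a(2I-J-J'); 0 0 0 0 -aJ; 0 0 0 0 -aJ'; 0 0 0 0 -aI₁; 0 0 0 0 I]`.
[cite: KazeevKhoromskij2012, Cor. 2.5] -/
theorem ndSupJunction_eq (c : K) (p : Fin 2 × Fin 2) :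
    supJunction K (lapNDCore K) ![(1 : K), 0, 0, 1] ![2, -1, -1, -1] c p =
      !![blkI K p, 0, 0, blkI K p, c * (2 * blkI K p - blkJ K p - blkJ' K p);
        0, 0, 0, 0, -c * blkJ K p; 0, 0, 0, 0, -c * blkJ' K p; 0, 0, 0, 0, -c * blkI₁ K p;
        0, 0, 0, 0, blkI K p] := by
  rw [supJunction, ← ndSupLast_eq, supBondL_mixed]
  ext i j
  fin_cases i <;> fin_cases j <;> simp [ndSupLast, Matrix.mul_apply, Fin.sum_univ_two]

/-- CHANNEL `0` OF THE `Δ_ND` AUTOMATON IS THE DIAGONAL INDICATOR: after `d` digit pairs the state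
`(1,0,0,1) · diag(W,I₁)(i₁,j₁) ⋯ diag(W,I₁)(i_d,j_d)` has `𝟙[m = n]` in channel `0` (Lem. 2.1/2.2).
[cite: KazeevKhoromskij2012, Lem. 2.2] -/
theorem vecMul_chainProd_lapNDCore_zero (d : ℕ) (σ μ : Fin d → Fin 2) :
    (![(1 : K), 0, 0, 1] ᵥ* TensorTrain.chainProd (fun _ => lapNDCore K) d (fun r => (σ r, μ r))) 0 =
      (1 : Matrix (Fin (2 ^ d)) (Fin (2 ^ d)) K) (quanticsEquiv 2 d σ) (quanticsEquiv 2 d μ) := by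
  rw [vecMul_chainProd_lapNDCore, Matrix.one_apply]
  simp [lapNDVec, Fin.val_inj]

/-- THE `Δ_ND` AUTOMATON CLOSED BY ITS BOUNDARY COLUMN gives `Δ_ND^{(d)}(m, n)` (Lem. 2.2 in row form).
[cite: KazeevKhoromskij2012, Lem. 2.2] -/
theorem vecMul_chainProd_lapNDCore_dotProduct (d : ℕ) (σ μ : Fin d → Fin 2) :
    ![(1 : K), 0, 0, 1] ᵥ* TensorTrain.chainProd (fun _ => lapNDCore K) d (fun r => (σ r, μ r)) ⬝ᵥ
        ![2, -1, -1, -1] =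
      laplaceND K (2 ^ d) (quanticsEquiv 2 d σ) (quanticsEquiv 2 d μ) := by
  rw [← eval_lapNDTrain, lapNDTrain, TensorTrain.eval_uniform]

/-- THE MIDDLE SUPERCORE IDENTITY WITH `Δ_ND` (uniform form, every `d ≥ 0`):
`E · diag(W,I₁,I)(i₁,j₁) ⋯ diag(W,I₁,I)(i_d,j_d) · B(c) = [𝟙[m=n] cΔ_ND^{(d)}(m,n); 0 𝟙[m=n]]`, the
block entry of `[I^{⊗d} cΔ_ND^{(d)}; 0 I^{⊗d}]`.  [cite: KazeevKhoromskij2012, Cor. 2.5] -/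
theorem supBondL_mul_chainProd_mul_supBondR_nd (c : K) (d : ℕ) (σ μ : Fin d → Fin 2) :
    supBondL K ![(1 : K), 0, 0, 1] *
        TensorTrain.chainProd (fun _ => supCore K (lapNDCore K)) d (fun r => (σ r, μ r)) *
        supBondR K c ![2, -1, -1, -1] =
      laplaceMultiCore c (laplaceND K (2 ^ d)) (quanticsEquiv 2 d σ, quanticsEquiv 2 d μ) :=
  supBondL_mul_chainProd_mul_supBondR _ _ _ _ c σ μ (vecMul_chainProd_lapNDCore_zero d σ μ)
    (vecMul_chainProd_lapNDCore_dotProduct d σ μ)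

/-- COROLLARY 2.5, MIDDLE SUPERCORE, VERBATIM (`d = k + 2 ≥ 2`): the `((i₁…i_d), (j₁…j_d))` block
entry of `[I J' J I₁ 0; 0 0 0 0 I] ⋈ [I J' J 0 0; 0 J 0 0 0; 0 0 J' 0 0; 0 0 0 I₁ 0; 0 0 0 0 I]^{⋈(d-2)}
⋈ [I a(2I-J-J'); 0 -aJ; 0 -aJ'; 0 -aI₁; 0 I]`, i.e. the `2 × 2` matrix
`ndSupFirst(i₁,j₁) · diag(W,I₁,I)(i₂,j₂) ⋯ diag(W,I₁,I)(i_{d-1},j_{d-1}) · ndSupLast a (i_d,j_d)`, is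
`[𝟙[m=n] aΔ_ND^{(d)}(m,n); 0 𝟙[m=n]]` — the block entry of the supercore `[I^{⊗d} a_kΔ_ND^{(d)}; 0 I^{⊗d}]`,
a rank-`5 ⋯ 5` QTT representation (the paper states it for `d ≥ 3`).
[cite: KazeevKhoromskij2012, Cor. 2.5] -/
theorem ndSupFirst_mul_chainProd_mul_ndSupLast (c : K) (k : ℕ) (σ μ : Fin (k + 2) → Fin 2) :
    ndSupFirst K (σ 0, μ 0) *
        TensorTrain.chainProd (fun _ => supCore K (lapNDCore K)) k
          (fun r : Fin k => (σ r.succ.castSucc, μ r.succ.castSucc)) *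
        ndSupLast K c (σ (Fin.last (k + 1)), μ (Fin.last (k + 1))) =
      laplaceMultiCore c (laplaceND K (2 ^ (k + 2)))
        (quanticsEquiv 2 (k + 2) σ, quanticsEquiv 2 (k + 2) μ) := by
  rw [← supBondL_mul_chainProd_mul_supBondR_nd c (k + 2) σ μ, TensorTrain.chainProd,
    TensorTrain.chainProd_succ_eq_mul, ndSupFirst_eq, ndSupLast_eq]
  simp only [Matrix.mul_assoc]
  rfl

/-- [folklore] `[I J' J I₁] = (1,0,0,1) ⋈ diag(W, I₁)` as a row matrix (bookkeeping). -/
private theorem ndFirst_eq_of (p : Fin 2 × Fin 2) :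
    ndFirst K p = Matrix.of fun (_ : Fin 1) j => (![(1 : K), 0, 0, 1] ᵥ* lapNDCore K p) j := by
  ext i j
  fin_cases i; fin_cases j <;>
    simp [ndFirst, lapNDCore, Matrix.vecMul, dotProduct, Fin.sum_univ_four]

/-- [folklore] `[2I-J-J'; -J; -J'; -I₁] = diag(W, I₁) ⋈ (2,-1,-1,-1)ᵀ` as a column matrix
(bookkeeping). -/
private theorem ndLast_eq_of (p : Fin 2 × Fin 2) :
    ndLast K p = Matrix.of fun i (_ : Fin 1) => (lapNDCore K p *ᵥ ![(2 : K), -1, -1, -1]) i := by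
  ext i j
  fin_cases j; fin_cases i <;>
    simp [ndLast, lapNDCore, Matrix.mulVec, dotProduct, Fin.sum_univ_four]
  ring

/-- COROLLARY 2.5, FIRST SUPERCORE, VERBATIM (`d = k + 2 ≥ 2`): the block entry of
`[I J' J I₁] ⋈ [I J' J 0; 0 J 0 0; 0 0 J' 0; 0 0 0 I₁]^{⋈(d-2)} ⋈ [I a(2I-J-J'); 0 -aJ; 0 -aJ'; 0 -aI₁]`
is `[𝟙[m=n] aΔ_ND^{(d)}(m,n)]`, the block entry of the first supercore `[I^{⊗d} a₁Δ_ND^{(d)}]` — a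
rank-`4 ⋯ 4` QTT representation.  [cite: KazeevKhoromskij2012, Cor. 2.5] -/
theorem ndFirst_mul_chainProd_mul_ndSupLast₁ (c : K) (k : ℕ) (σ μ : Fin (k + 2) → Fin 2) :
    ndFirst K (σ 0, μ 0) *
        TensorTrain.chainProd (fun _ => lapNDCore K) k
          (fun r : Fin k => (σ r.succ.castSucc, μ r.succ.castSucc)) *
        ndSupLast₁ K c (σ (Fin.last (k + 1)), μ (Fin.last (k + 1))) =
      !![(1 : Matrix (Fin (2 ^ (k + 2))) (Fin (2 ^ (k + 2))) K)
          (quanticsEquiv 2 (k + 2) σ) (quanticsEquiv 2 (k + 2) μ),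
        c * laplaceND K (2 ^ (k + 2)) (quanticsEquiv 2 (k + 2) σ) (quanticsEquiv 2 (k + 2) μ)] := by
  have key : (![(1 : K), 0, 0, 1] ᵥ*
        TensorTrain.chainProd (fun _ => lapNDCore K) (k + 2) (fun r => (σ r, μ r))) ᵥ*
        supBondR₁ K c ![(2 : K), -1, -1, -1] =
      ((![(1 : K), 0, 0, 1] ᵥ* lapNDCore K (σ 0, μ 0)) ᵥ*
        TensorTrain.chainProd (fun _ => lapNDCore K) k
          (fun r : Fin k => (σ r.succ.castSucc, μ r.succ.castSucc))) ᵥ*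
        (lapNDCore K (σ (Fin.last (k + 1)), μ (Fin.last (k + 1))) *
          supBondR₁ K c ![(2 : K), -1, -1, -1]) := by
    rw [TensorTrain.chainProd, TensorTrain.chainProd_succ_eq_mul]
    simp only [Matrix.vecMul_vecMul, Matrix.mul_assoc]
    rfl
  ext i j
  fin_cases i
  rw [ndFirst_eq_of, ndSupLast₁_eq, of_row_mul, of_row_mul, Matrix.of_apply, ← key,
    vecMul_chainProd_vecMul_supBondR₁ (lapNDCore K) _ _ (laplaceND K (2 ^ (k + 2))) c σ μ
      (vecMul_chainProd_lapNDCore_zero (k + 2) σ μ)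
      (vecMul_chainProd_lapNDCore_dotProduct (k + 2) σ μ)]
  fin_cases j <;> simp

/-- COROLLARY 2.5, LAST SUPERCORE BEFORE REDUCTION (first equality of its proof; `d = k + 2 ≥ 2`):
the block entry of `[I J' J I₁ 0; 0 0 0 0 I] ⋈ diag(W, I₁, I)^{⋈(d-2)} ⋈ [a(2I-J-J'); -aJ; -aJ'; -aI₁; I]`
is the column `[aΔ_ND^{(d)}(m,n); 𝟙[m=n]]`, the block entry of the last supercore
`[a_DΔ_ND^{(d)}; I^{⊗d}]` — rank `5 ⋯ 5` before the terminal reduction.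
[cite: KazeevKhoromskij2012, Cor. 2.5] -/
theorem ndSupFirst_mul_chainProd_mul_ndSupLastCol (c : K) (k : ℕ) (σ μ : Fin (k + 2) → Fin 2) :
    ndSupFirst K (σ 0, μ 0) *
        TensorTrain.chainProd (fun _ => supCore K (lapNDCore K)) k
          (fun r : Fin k => (σ r.succ.castSucc, μ r.succ.castSucc)) *
        ndSupLastCol K c (σ (Fin.last (k + 1)), μ (Fin.last (k + 1))) =
      !![c * laplaceND K (2 ^ (k + 2)) (quanticsEquiv 2 (k + 2) σ) (quanticsEquiv 2 (k + 2) μ);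
        (1 : Matrix (Fin (2 ^ (k + 2))) (Fin (2 ^ (k + 2))) K)
          (quanticsEquiv 2 (k + 2) σ) (quanticsEquiv 2 (k + 2) μ)] := by
  have hchain : supCore K (lapNDCore K) (σ 0, μ 0) *
        TensorTrain.chainProd (fun _ => supCore K (lapNDCore K)) k
          (fun r : Fin k => (σ r.succ.castSucc, μ r.succ.castSucc)) *
        supCore K (lapNDCore K) (σ (Fin.last (k + 1)), μ (Fin.last (k + 1))) =
      TensorTrain.chainProd (fun _ => supCore K (lapNDCore K)) (k + 2) (fun r => (σ r, μ r)) := by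
    rw [TensorTrain.chainProd, TensorTrain.chainProd_succ_eq_mul]
    rfl
  rw [← supBondL_mul_chainProd_mul_col (lapNDCore K) _ _ (laplaceND K (2 ^ (k + 2))) c σ μ
      (vecMul_chainProd_lapNDCore_zero (k + 2) σ μ) (vecMul_chainProd_lapNDCore_dotProduct (k + 2) σ μ),
    ← hchain, ndSupFirst_eq, ndSupLastCol_eq]
  simp only [Matrix.mul_assoc, mul_of_col]

/-- COROLLARY 2.3 WITH THE SUPERCORES OF COR. 2.5 SUBSTITUTED (Rem. 1.2): for `d ≥ 1` the assembled
`Δ_ND` train evaluates, at the bit-pair string `(τ_ℓ, τ'_ℓ)`, to the entry of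
`Σ_k I ⊗ ⋯ ⊗ a_kΔ_ND^{(d)} ⊗ ⋯ ⊗ I` at the serialised multi-indices.
[cite: KazeevKhoromskij2012, Cor. 2.5] -/
theorem eval_lapMultiNDTrain (a : ℕ → K) (D d : ℕ) (hd : 0 < d) (τ τ' : Fin (D * d) → Fin 2) :
    (lapMultiNDTrain K a D d).eval (fun ℓ => (τ ℓ, τ' ℓ)) =
      laplaceMulti (fun k : Fin D => a k) (fun _ => laplaceND K (2 ^ d)) (serialEquiv 2 D d τ)
        (serialEquiv 2 D d τ') :=
  eval_supTrain (lapNDCore K) _ _ a D d hd (laplaceND K (2 ^ d)) (vecMul_chainProd_lapNDCore_zero d)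
    (vecMul_chainProd_lapNDCore_dotProduct d) τ τ'

/-- THE QTT DECOMPOSITION OF THE `D`-DIMENSIONAL NEUMANN–DIRICHLET LAPLACE OPERATOR (Cor. 2.3 +
Cor. 2.5, uniform grids `2^d × ⋯ × 2^d`): the TT matrix of the assembled train is
`Σ_k I ⊗ ⋯ ⊗ a_kΔ_ND^{(2^d)} ⊗ ⋯ ⊗ I` with its multi-indices serialised dimension by dimension.
[cite: KazeevKhoromskij2012, Cor. 2.5] -/
theorem ttMatrix_lapMultiNDTrain (a : ℕ → K) (D d : ℕ) (hd : 0 < d) :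
    (lapMultiNDTrain K a D d).ttMatrix =
      (laplaceMulti (fun k : Fin D => a k) (fun _ => laplaceND K (2 ^ d))).submatrix
        (serialEquiv 2 D d) (serialEquiv 2 D d) :=
  ttMatrix_supTrain (lapNDCore K) _ _ a D d hd (laplaceND K (2 ^ d))
    (vecMul_chainProd_lapNDCore_zero d) (vecMul_chainProd_lapNDCore_dotProduct d)

end NeumannDirichlet

section NeumannDirichletReduced

variable (K : Type u) [Field K]

/-- THE PENULTIMATE QTT CORE `[aI aJ' aJ 0; 0 aJ 0 0; 0 0 aJ' 0; 0 0 0 aI₁; ½I -½I -½I 0]` (`5 × 4`)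
of the reduced last supercore `[a_DΔ_ND^{(d)}; I^{⊗d}]` of Cor. 2.5 (third display).
[cite: KazeevKhoromskij2012, Cor. 2.5] -/
def ndSupPenult (c : K) (p : Fin 2 × Fin 2) : Matrix (Fin 5) (Fin 4) K :=
  !![c * blkI K p, c * blkJ' K p, c * blkJ K p, 0; 0, c * blkJ K p, 0, 0; 0, 0, c * blkJ' K p, 0;
    0, 0, 0, c * blkI₁ K p; 2⁻¹ * blkI K p, -2⁻¹ * blkI K p, -2⁻¹ * blkI K p, 0]

variable {K}

/-- `ndSupPenult c = diag(W, I₁, I) ⋈ Z(c)` (bookkeeping).  [cite: KazeevKhoromskij2012, Cor. 2.5] -/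
theorem ndSupPenult_eq (c : K) (p : Fin 2 × Fin 2) :
    ndSupPenult K c p = supCore K (lapNDCore K) p * mixedSupZ K c := by
  rw [supCore_lapNDCore]
  ext i j
  fin_cases i <;> fin_cases j <;>
    simp [ndSupPenult, mixedSupZ, Matrix.mul_apply, Fin.sum_univ_five, mul_comm]

/-- THE SWEEP OF COR. 2.5's THIRD DISPLAY (where `½` enters): for every digit pair,
`Z(c) · (diag(W,I₁) ⋈ (2,-1,-1,-1)ᵀ) = diag(W,I₁,I) · (B(c) ⋈ (0,1)ᵀ)`, i.e.
`Z(c)·[2I-J-J'; -J; -J'; -I₁] = [c(2I-J-J'); -cJ; -cJ'; -cI₁; I]`; the last row is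
`½(2I-J-J') + ½J + ½J' = I`.  Requires `2 ≠ 0` in `K`.  [cite: KazeevKhoromskij2012, Cor. 2.5] -/
theorem mixedSupZ_mulVec_lapNDCore_mulVec [NeZero (2 : K)] (c : K) (p : Fin 2 × Fin 2) :
    mixedSupZ K c *ᵥ (lapNDCore K p *ᵥ ![2, -1, -1, -1]) =
      supCore K (lapNDCore K) p *ᵥ (supBondR K c ![(2 : K), -1, -1, -1] *ᵥ ![(0 : K), 1]) := by
  rw [supCore_lapNDCore, supBondR_mixed]
  obtain ⟨a, a'⟩ := p
  ext j
  fin_cases a <;> fin_cases a' <;> fin_cases j <;>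
    simp [mixedSupZ, lapNDCore, blkI, blkJ, blkJ', blkI₁, Matrix.mulVec, dotProduct,
      Fin.sum_univ_two, Fin.sum_univ_four, Fin.sum_univ_five] <;>
    first | ring1 | exact inv_mul_cancel₀ two_ne_zero

/-- COROLLARY 2.5, LAST SUPERCORE, VERBATIM (`d = k + 3 ≥ 3`, `2 ≠ 0` in `K`): the block entry of
`[I J' J I₁ 0; 0 0 0 0 I] ⋈ [I J' J 0 0; 0 J 0 0 0; 0 0 J' 0 0; 0 0 0 I₁ 0; 0 0 0 0 I]^{⋈(d-3)}
   ⋈ [aI aJ' aJ 0; 0 aJ 0 0; 0 0 aJ' 0; 0 0 0 aI₁; ½I -½I -½I 0] ⋈ [2I-J-J'; -J; -J'; -I₁]`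
is `[aΔ_ND^{(d)}(m,n); 𝟙[m=n]]`, the block entry of the last supercore `[a_DΔ_ND^{(d)}; I^{⊗d}]` —
a rank-`5 ⋯ 5, 4` QTT representation.  [cite: KazeevKhoromskij2012, Cor. 2.5] -/
theorem ndSupFirst_mul_chainProd_mul_ndSupPenult_mul_ndLast [NeZero (2 : K)] (c : K) (k : ℕ)
    (σ μ : Fin (k + 3) → Fin 2) :
    ndSupFirst K (σ 0, μ 0) *
          TensorTrain.chainProd (fun _ => supCore K (lapNDCore K)) k
            (fun r : Fin k => (σ r.succ.castSucc.castSucc, μ r.succ.castSucc.castSucc)) *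
        ndSupPenult K c (σ (Fin.last (k + 1)).castSucc, μ (Fin.last (k + 1)).castSucc) *
        ndLast K (σ (Fin.last (k + 2)), μ (Fin.last (k + 2))) =
      !![c * laplaceND K (2 ^ (k + 3)) (quanticsEquiv 2 (k + 3) σ) (quanticsEquiv 2 (k + 3) μ);
        (1 : Matrix (Fin (2 ^ (k + 3))) (Fin (2 ^ (k + 3))) K)
          (quanticsEquiv 2 (k + 3) σ) (quanticsEquiv 2 (k + 3) μ)] := by
  have hchain : supCore K (lapNDCore K) (σ 0, μ 0) *
        TensorTrain.chainProd (fun _ => supCore K (lapNDCore K)) k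
          (fun r : Fin k => (σ r.succ.castSucc.castSucc, μ r.succ.castSucc.castSucc)) *
        supCore K (lapNDCore K) (σ (Fin.last (k + 1)).castSucc, μ (Fin.last (k + 1)).castSucc) *
        supCore K (lapNDCore K) (σ (Fin.last (k + 2)), μ (Fin.last (k + 2))) =
      TensorTrain.chainProd (fun _ => supCore K (lapNDCore K)) (k + 3) (fun r => (σ r, μ r)) := by
    rw [TensorTrain.chainProd, TensorTrain.chainProd, TensorTrain.chainProd_succ_eq_mul]
    rfl
  rw [← supBondL_mul_chainProd_mul_col (lapNDCore K) _ _ (laplaceND K (2 ^ (k + 3))) c σ μ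
      (vecMul_chainProd_lapNDCore_zero (k + 3) σ μ) (vecMul_chainProd_lapNDCore_dotProduct (k + 3) σ μ),
    ← hchain, ndSupFirst_eq, ndSupPenult_eq, ndLast_eq_of]
  simp only [Matrix.mul_assoc, mul_of_col, mixedSupZ_mulVec_lapNDCore_mulVec]

end NeumannDirichletReduced

section NeumannDirichletRanks

variable {K : Type u} [Field K]

/-- THEOREM 4.1 FOR `Δ_ND^{(d…d)}`, THE `5`s: every unfolding matrix of the assembled train has rank
`≤ 5` (line `4…4, 2, 5…5, 2, …, 2, 5…5, 4`).  [cite: KazeevKhoromskij2012, Thm. 4.1] -/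
theorem rank_unfolding_lapMultiNDTrain_le (a : ℕ → K) (D d k m : ℕ) (h : k + m = D * d) :
    (Matrix.of fun (s : Fin k → Fin 2 × Fin 2) (t : Fin m → Fin 2 × Fin 2) =>
        (lapMultiNDTrain K a D d).eval (fun i => Fin.append s t (i.cast h.symm))).rank ≤ 5 :=
  rank_unfolding_supTrain_le (lapNDCore K) _ _ a D d k m h

/-- THEOREM 4.1 FOR `Δ_ND^{(d…d)}`, THE `2`s: across the bond after the last site of each dimension
the unfolding rank is `≤ 2`.  [cite: KazeevKhoromskij2012, Thm. 4.1] -/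
theorem rank_unfolding_lapMultiNDTrain_junction_le (a : ℕ → K) (D d ℓ m : ℕ) (hℓ : ℓ % d = d - 1)
    (h : ℓ + 1 + m = D * d) :
    (Matrix.of fun (s : Fin (ℓ + 1) → Fin 2 × Fin 2) (t : Fin m → Fin 2 × Fin 2) =>
        (lapMultiNDTrain K a D d).eval (fun i => Fin.append s t (i.cast h.symm))).rank ≤ 2 :=
  rank_unfolding_supTrain_junction_le (lapNDCore K) _ _ a D d ℓ m hℓ h

/-- THEOREM 4.1 FOR `Δ_ND^{(d…d)}`, THE LEADING `4…4`: inside the first supercore (after `k < d`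
sites) the unfolding rank is `≤ 4`.  [cite: KazeevKhoromskij2012, Thm. 4.1] -/
theorem rank_unfolding_lapMultiNDTrain_head_le (a : ℕ → K) (D d k m : ℕ) (hk : k < d)
    (h : k + m = D * d) :
    (Matrix.of fun (s : Fin k → Fin 2 × Fin 2) (t : Fin m → Fin 2 × Fin 2) =>
        (lapMultiNDTrain K a D d).eval (fun i => Fin.append s t (i.cast h.symm))).rank ≤ 4 :=
  rank_unfolding_supTrain_head_le (lapNDCore K) _ _ a D d k m hk h

/-- [folklore] The column entering the last site factors through `mixedLastZ` (bookkeeping case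
analysis): `diag(W,I₁,I)(p) · (2c,-c,-c,-c,1)ᵀ = mixedLastZ(c) · (-cJ, -cJ', -cI₁, I)(p)`. -/
private theorem supCore_lapNDCore_mulVec (c : K) (p : Fin 2 × Fin 2) :
    supCore K (lapNDCore K) p *ᵥ (supBondR K c ![(2 : K), -1, -1, -1] *ᵥ ![(0 : K), 1]) =
      mixedLastZ K c *ᵥ ![-c * blkJ K p, -c * blkJ' K p, -c * blkI₁ K p, blkI K p] := by
  rw [supCore_lapNDCore, supBondR_mixed]
  ext j
  fin_cases j <;>
    simp [mixedLastZ, Matrix.mulVec, dotProduct, Fin.sum_univ_two, Fin.sum_univ_four,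
      Fin.sum_univ_five] <;> ring

/-- THEOREM 4.1 FOR `Δ_ND^{(d…d)}`, THE TRAILING `4`: across the very last bond the unfolding rank is
`≤ 4` (the `5 × 4` penultimate core of Cor. 2.5's third display).
[cite: KazeevKhoromskij2012, Thm. 4.1] -/
theorem rank_unfolding_lapMultiNDTrain_last_le (a : ℕ → K) (D d k : ℕ) (h : k + 1 = D * d) :
    (Matrix.of fun (s : Fin k → Fin 2 × Fin 2) (t : Fin 1 → Fin 2 × Fin 2) =>
        (lapMultiNDTrain K a D d).eval (fun i => Fin.append s t (i.cast h.symm))).rank ≤ 4 :=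
  rank_unfolding_supTrain_last_le_of (lapNDCore K) _ _ a D d k h (fun c => mixedLastZ K c)
    (fun c p => ![-c * blkJ K p, -c * blkJ' K p, -c * blkI₁ K p, blkI K p])
    (supCore_lapNDCore_mulVec)

end NeumannDirichletRanks

/-! ### Corollary 2.6: the supercores with the Neumann factor `Δ_NN` -/

section NeumannBonds

variable (K : Type u) [CommRing K]

/-- The left bond matrix `diag(M, 1) = [1 0 0 0 1 0; 0 1 0 0 0 0; 0 0 1 0 0 0; 0 0 0 1 -1 0; 0 0 0 0 0 1]`
(`5 × 6`) of the rank reduction at the head of every supercore with `Δ_NN` (`M` of Lem. 2.2 and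
the identity channel): `second core = diag(M, 1) ⋈ diag(W, I₂, I₁, I)`.
[cite: KazeevKhoromskij2012, Cor. 2.6] -/
def nnSupM : Matrix (Fin 5) (Fin 6) K :=
  !![1, 0, 0, 0, 1, 0; 0, 1, 0, 0, 0, 0; 0, 0, 1, 0, 0, 0; 0, 0, 0, 1, -1, 0; 0, 0, 0, 0, 0, 1]

/-- The right bond matrix `Y(c) = [1 0 0 0 0; 0 1 0 0 0; 0 0 1 0 0; 0 0 0 c 0; 0 0 0 0 c; 0 0 0 -1 -1]`
(`6 × 5`) of the rank reduction at the tail of the middle supercore with `Δ_NN`: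
`penultimate core = diag(W, I₂, I₁, I) ⋈ Y(a_k)`.  [cite: KazeevKhoromskij2012, Cor. 2.6] -/
def nnSupY (c : K) : Matrix (Fin 6) (Fin 5) K :=
  !![1, 0, 0, 0, 0; 0, 1, 0, 0, 0; 0, 0, 1, 0, 0; 0, 0, 0, c, 0; 0, 0, 0, 0, c; 0, 0, 0, -1, -1]

/-- The bond matrix `[1 1 0 2c; 1 0 0 0; 0 1 0 0; 0 0 1 0; 0 0 -1 -c; 0 0 0 1]` (`6 × 4`) through which
the column entering the last site of the assembled `Δ_NN` train factors (rank count `4` at the last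
bond, using `I₁ = I - I₂`; uniform-form device).  [cite: KazeevKhoromskij2012, Thm. 4.1] -/
def nnLastZ (c : K) : Matrix (Fin 6) (Fin 4) K :=
  !![1, 1, 0, 2 * c; 1, 0, 0, 0; 0, 1, 0, 0; 0, 0, 1, 0; 0, 0, -1, -c; 0, 0, 0, 1]

variable {K}

/-- THE LEFT BOND MATRIX OF COR. 2.6 WRITTEN OUT: `E = [1 0 0 1 1 0; 0 0 0 0 0 1]` for the boundary
row `(1, 0, 0, 1, 1)` of the rank-`5` representation of `Δ_NN` (proof of Lem. 2.2).
[cite: KazeevKhoromskij2012, Cor. 2.6] -/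
theorem supBondL_nn :
    supBondL K ![(1 : K), 0, 0, 1, 1] = !![1, 0, 0, 1, 1, 0; 0, 0, 0, 0, 0, 1] := by
  ext i j
  fin_cases i <;> fin_cases j <;> simp [supBondL, Fin.snoc]

/-- THE RIGHT BOND MATRIX OF COR. 2.6 WRITTEN OUT: `B(c) = [1 2c; 0 -c; 0 -c; 0 -c; 0 -c; 0 1]` for
the boundary column `(2, -1, -1, -1, -1)` of `Δ_NN`.  [cite: KazeevKhoromskij2012, Cor. 2.6] -/
theorem supBondR_nn (c : K) :
    supBondR K c ![(2 : K), -1, -1, -1, -1] = !![1, 2 * c; 0, -c; 0, -c; 0, -c; 0, -c; 0, 1] := by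
  ext i j
  fin_cases i <;> fin_cases j <;> simp [supBondR, Fin.snoc, mul_comm]

/-- `B₁(c) = [1 2c; 0 -c; 0 -c; 0 -c; 0 -c]` written out.  [cite: KazeevKhoromskij2012, Cor. 2.6] -/
theorem supBondR₁_nn (c : K) :
    supBondR₁ K c ![(2 : K), -1, -1, -1, -1] = !![1, 2 * c; 0, -c; 0, -c; 0, -c; 0, -c] := by
  ext i j
  fin_cases i <;> fin_cases j <;> simp [supBondR₁, mul_comm]

end NeumannBonds

section NeumannNeumann

variable (K : Type u) [CommRing K]

/-- THE SECOND QTT CORE `[I J' J 0 I₁ 0; 0 J 0 0 0 0; 0 0 J' 0 0 0; 0 0 0 I₂ -I₁ 0; 0 0 0 0 0 I]`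
(`5 × 6`, blank = zero block) of the supercores of Cor. 2.6 (all three displays).
[cite: KazeevKhoromskij2012, Cor. 2.6] -/
def nnSupSecond (p : Fin 2 × Fin 2) : Matrix (Fin 5) (Fin 6) K :=
  !![blkI K p, blkJ' K p, blkJ K p, 0, blkI₁ K p, 0; 0, blkJ K p, 0, 0, 0, 0;
    0, 0, blkJ' K p, 0, 0, 0; 0, 0, 0, blkI₂ K p, -blkI₁ K p, 0; 0, 0, 0, 0, 0, blkI K p]

/-- THE PENULTIMATE QTT CORE `[I J' J 0 0; 0 J 0 0 0; 0 0 J' 0 0; 0 0 0 aI₂ 0; 0 0 0 0 aI₁; 0 0 0 -I -I]`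
(`6 × 5`) of the middle supercore `[I^{⊗d} a_kΔ_NN^{(d)}; 0 I^{⊗d}]` of Cor. 2.6 (first display).
[cite: KazeevKhoromskij2012, Cor. 2.6] -/
def nnSupPenult (c : K) (p : Fin 2 × Fin 2) : Matrix (Fin 6) (Fin 5) K :=
  !![blkI K p, blkJ' K p, blkJ K p, 0, 0; 0, blkJ K p, 0, 0, 0; 0, 0, blkJ' K p, 0, 0;
    0, 0, 0, c * blkI₂ K p, 0; 0, 0, 0, 0, c * blkI₁ K p; 0, 0, 0, -blkI K p, -blkI K p]

/-- THE LAST QTT CORE `[I a(2I-J-J'); 0 -aJ; 0 -aJ'; 0 -I₂; 0 -I₁]` (`5 × 2`) of the middle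
supercore of Cor. 2.6 (first display; the weight `a` of the `I₂`, `I₁` rows sits in the
penultimate core).  [cite: KazeevKhoromskij2012, Cor. 2.6] -/
def nnSupLast (c : K) (p : Fin 2 × Fin 2) : Matrix (Fin 5) (Fin 2) K :=
  !![blkI K p, c * (2 * blkI K p - blkJ K p - blkJ' K p); 0, -c * blkJ K p; 0, -c * blkJ' K p;
    0, -blkI₂ K p; 0, -blkI₁ K p]

/-- THE LAST QTT CORE `[I a(2I-J-J'); 0 -aJ; 0 -aJ'; 0 -aI₂; 0 -aI₁]` (`5 × 2`) of the first
supercore `[I^{⊗d} a₁Δ_NN^{(d)}]` of Cor. 2.6 (second display), `= diag(W, I₂, I₁) ⋈ B₁(a)`.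
[cite: KazeevKhoromskij2012, Cor. 2.6] -/
def nnSupLast₁ (c : K) (p : Fin 2 × Fin 2) : Matrix (Fin 5) (Fin 2) K :=
  !![blkI K p, c * (2 * blkI K p - blkJ K p - blkJ' K p); 0, -c * blkJ K p; 0, -c * blkJ' K p;
    0, -c * blkI₂ K p; 0, -c * blkI₁ K p]

/-- The unreduced last QTT core `[a(2I-J-J'); -aJ; -aJ'; -aI₂; -aI₁; I]` (`6 × 1`) of the last
supercore `[a_DΔ_NN^{(d)}; I^{⊗d}]` (the analogue of the first equality in the proof of Cor. 2.5, to
which the proof of Cor. 2.6 refers).  [cite: KazeevKhoromskij2012, Cor. 2.6] -/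
def nnSupLastCol (c : K) (p : Fin 2 × Fin 2) : Matrix (Fin 6) (Fin 1) K :=
  !![c * (2 * blkI K p - blkJ K p - blkJ' K p); -c * blkJ K p; -c * blkJ' K p; -c * blkI₂ K p;
    -c * blkI₁ K p; blkI K p]

/-- THE ASSEMBLED QTT TRAIN OF `Σ_k I ⊗ ⋯ ⊗ a_kΔ_NN^{(d)} ⊗ ⋯ ⊗ I` (eq. (3) with Neumann factors, all
`d_k = d`): the device `supTrain` with the rank-`5` `Δ_NN` data of Lem. 2.2 — cores
`diag(W, I₂, I₁, I)`, boundary row `(1, 0, 0, 1, 1)`, boundary column `(2, -1, -1, -1, -1)`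
(uniform bond dimension `6`; the reduced ranks of Cor. 2.6 appear as unfolding-rank bounds below).
[cite: KazeevKhoromskij2012, Cor. 2.6] -/
def lapMultiNNTrain (a : ℕ → K) (D d : ℕ) : TensorTrain K (Fin 2 × Fin 2) (D * d) :=
  supTrain K (lapNNCore K) ![1, 0, 0, 1, 1] ![2, -1, -1, -1, -1] a D d

variable {K}

/-- THE MIDDLE QTT CORE OF COR. 2.6 WRITTEN OUT: `diag(W, I₂, I₁, I) =
[I J' J 0 0 0; 0 J 0 0 0 0; 0 0 J' 0 0 0; 0 0 0 I₂ 0 0; 0 0 0 0 I₁ 0; 0 0 0 0 0 I]` (`6 × 6`).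
[cite: KazeevKhoromskij2012, Cor. 2.6] -/
theorem supCore_lapNNCore (p : Fin 2 × Fin 2) :
    supCore K (lapNNCore K) p =
      !![blkI K p, blkJ' K p, blkJ K p, 0, 0, 0; 0, blkJ K p, 0, 0, 0, 0; 0, 0, blkJ' K p, 0, 0, 0;
        0, 0, 0, blkI₂ K p, 0, 0; 0, 0, 0, 0, blkI₁ K p, 0; 0, 0, 0, 0, 0, blkI K p] := by
  ext i j
  fin_cases i <;> fin_cases j <;> simp [supCore, lapNNCore]

/-- `nnSupSecond = diag(M, 1) ⋈ diag(W, I₂, I₁, I)` (bookkeeping).  [cite: KazeevKhoromskij2012, Cor. 2.6] -/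
theorem nnSupSecond_eq (p : Fin 2 × Fin 2) : nnSupSecond K p = nnSupM K * supCore K (lapNNCore K) p := by
  rw [supCore_lapNNCore]
  ext i j
  fin_cases i <;> fin_cases j <;> simp [nnSupSecond, nnSupM, Matrix.mul_apply, Fin.sum_univ_six]

/-- THE HEAD REDUCTION OF COR. 2.6: `[I J' J I₂ 0; 0 0 0 0 I] ⋈ diag(M, 1) = E ⋈ diag(W, I₂, I₁, I)`
("due to the fact that `I₁ + I₂ = I`", proof of Lem. 2.2) — the first core of the `Δ_DN` supercore
followed by `diag(M, 1)` is the generic first core of the `Δ_NN` supercore.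
[cite: KazeevKhoromskij2012, Cor. 2.6] -/
theorem dnSupFirst_mul_nnSupM (p : Fin 2 × Fin 2) :
    dnSupFirst K p * nnSupM K = supBondL K ![(1 : K), 0, 0, 1, 1] * supCore K (lapNNCore K) p := by
  rw [supBondL_nn, supCore_lapNNCore]
  obtain ⟨a, a'⟩ := p
  ext i j
  fin_cases a <;> fin_cases a' <;> fin_cases i <;> fin_cases j <;>
    simp [dnSupFirst, nnSupM, blkI, blkJ, blkJ', blkI₁, blkI₂, Matrix.mul_apply, Fin.sum_univ_five,
      Fin.sum_univ_six]

/-- `nnSupPenult a = diag(W, I₂, I₁, I) ⋈ Y(a)` (bookkeeping).  [cite: KazeevKhoromskij2012, Cor. 2.6] -/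
theorem nnSupPenult_eq (c : K) (p : Fin 2 × Fin 2) :
    nnSupPenult K c p = supCore K (lapNNCore K) p * nnSupY K c := by
  rw [supCore_lapNNCore]
  ext i j
  fin_cases i <;> fin_cases j <;> simp [nnSupPenult, nnSupY, Matrix.mul_apply, Fin.sum_univ_six, mul_comm]

/-- THE TAIL REDUCTION OF COR. 2.6: `Y(a) ⋈ [I a(2I-J-J'); 0 -aJ; 0 -aJ'; 0 -I₂; 0 -I₁] =
diag(W, I₂, I₁, I) ⋈ B(a)` (uses `I₁ + I₂ = I` in the last row) — the reduced penultimate and last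
cores of the first display multiply to the generic tail of the supercore.
[cite: KazeevKhoromskij2012, Cor. 2.6] -/
theorem nnSupY_mul_nnSupLast (c : K) (p : Fin 2 × Fin 2) :
    nnSupY K c * nnSupLast K c p = supCore K (lapNNCore K) p * supBondR K c ![(2 : K), -1, -1, -1, -1] := by
  rw [supBondR_nn, supCore_lapNNCore]
  obtain ⟨a, a'⟩ := p
  ext i j
  fin_cases a <;> fin_cases a' <;> fin_cases i <;> fin_cases j <;>
    simp [nnSupY, nnSupLast, blkI, blkJ, blkJ', blkI₁, blkI₂, Matrix.mul_apply, Fin.sum_univ_five,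
      Fin.sum_univ_six] <;> ring

/-- `[I a(2I-J-J'); 0 -aJ; 0 -aJ'; 0 -aI₂; 0 -aI₁] = diag(W, I₂, I₁) ⋈ B₁(a)` (bookkeeping).
[cite: KazeevKhoromskij2012, Cor. 2.6] -/
theorem nnSupLast₁_eq (c : K) (p : Fin 2 × Fin 2) :
    nnSupLast₁ K c p = lapNNCore K p * supBondR₁ K c ![(2 : K), -1, -1, -1, -1] := by
  rw [supBondR₁_nn]
  ext i j
  fin_cases i <;> fin_cases j <;>
    simp [nnSupLast₁, lapNNCore, Matrix.mul_apply, Fin.sum_univ_five, mul_comm]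
  ring

/-- [folklore] The generic tail `diag(W, I₂, I₁, I) ⋈ B(a)` written out (bookkeeping). -/
private theorem supCore_lapNNCore_mul_supBondR (c : K) (p : Fin 2 × Fin 2) :
    supCore K (lapNNCore K) p * supBondR K c ![(2 : K), -1, -1, -1, -1] =
      !![blkI K p, c * (2 * blkI K p - blkJ K p - blkJ' K p); 0, -c * blkJ K p; 0, -c * blkJ' K p;
        0, -c * blkI₂ K p; 0, -c * blkI₁ K p; 0, blkI K p] := by
  rw [supBondR_nn, supCore_lapNNCore]
  ext i j
  fin_cases i <;> fin_cases j <;> simp [Matrix.mul_apply, Fin.sum_univ_six, mul_comm]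
  ring

/-- `[a(2I-J-J'); -aJ; -aJ'; -aI₂; -aI₁; I] = diag(W, I₂, I₁, I) ⋈ (B(a) ⋈ (0, 1)ᵀ)`, the last column
of the generic tail (bookkeeping).  [cite: KazeevKhoromskij2012, Cor. 2.6] -/
theorem nnSupLastCol_eq (c : K) (p : Fin 2 × Fin 2) :
    nnSupLastCol K c p = Matrix.of fun i (_ : Fin 1) =>
      (supCore K (lapNNCore K) p *ᵥ (supBondR K c ![(2 : K), -1, -1, -1, -1] *ᵥ ![(0 : K), 1])) i := by
  have hB : supBondR K c ![(2 : K), -1, -1, -1, -1] *ᵥ ![(0 : K), 1] =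
      fun j => supBondR K c ![(2 : K), -1, -1, -1, -1] j 1 := by
    ext j
    simp [Matrix.mulVec, dotProduct, Fin.sum_univ_two]
  have hcol : ∀ i, (supCore K (lapNNCore K) p *ᵥ
      (supBondR K c ![(2 : K), -1, -1, -1, -1] *ᵥ ![(0 : K), 1])) i =
        (supCore K (lapNNCore K) p * supBondR K c ![(2 : K), -1, -1, -1, -1]) i 1 := fun i => by
    rw [hB]; rfl
  ext i j
  fin_cases j
  simp only [Matrix.of_apply, hcol, supCore_lapNNCore_mul_supBondR]
  fin_cases i <;> simp [nnSupLastCol]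

/-- THE JUNCTION CORE OF THE ASSEMBLED `Δ_NN` TRAIN WRITTEN OUT: `diag(W, I₂, I₁, I) ⋈ B(a) ⋈ E =
[I 0 0 I I a(2I-J-J'); 0 0 0 0 0 -aJ; 0 0 0 0 0 -aJ'; 0 0 0 0 0 -aI₂; 0 0 0 0 0 -aI₁; 0 0 0 0 0 I]`.
[cite: KazeevKhoromskij2012, Cor. 2.6] -/
theorem nnSupJunction_eq (c : K) (p : Fin 2 × Fin 2) :
    supJunction K (lapNNCore K) ![(1 : K), 0, 0, 1, 1] ![2, -1, -1, -1, -1] c p =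
      !![blkI K p, 0, 0, blkI K p, blkI K p, c * (2 * blkI K p - blkJ K p - blkJ' K p);
        0, 0, 0, 0, 0, -c * blkJ K p; 0, 0, 0, 0, 0, -c * blkJ' K p; 0, 0, 0, 0, 0, -c * blkI₂ K p;
        0, 0, 0, 0, 0, -c * blkI₁ K p; 0, 0, 0, 0, 0, blkI K p] := by
  rw [supJunction, supCore_lapNNCore_mul_supBondR, supBondL_nn]
  ext i j
  fin_cases i <;> fin_cases j <;> simp [Matrix.mul_apply, Fin.sum_univ_two]

/-- CHANNEL `0` OF THE `Δ_NN` AUTOMATON IS THE DIAGONAL INDICATOR `𝟙[m = n]` (Lem. 2.1/2.2).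
[cite: KazeevKhoromskij2012, Lem. 2.2] -/
theorem vecMul_chainProd_lapNNCore_zero (d : ℕ) (σ μ : Fin d → Fin 2) :
    (![(1 : K), 0, 0, 1, 1] ᵥ* TensorTrain.chainProd (fun _ => lapNNCore K) d (fun r => (σ r, μ r))) 0 =
      (1 : Matrix (Fin (2 ^ d)) (Fin (2 ^ d)) K) (quanticsEquiv 2 d σ) (quanticsEquiv 2 d μ) := by
  rw [vecMul_chainProd_lapNNCore, Matrix.one_apply]
  simp [lapNNVec, Fin.val_inj]

/-- THE `Δ_NN` AUTOMATON CLOSED BY ITS BOUNDARY COLUMN gives `Δ_NN^{(d)}(m, n)` (Lem. 2.2, row form).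
[cite: KazeevKhoromskij2012, Lem. 2.2] -/
theorem vecMul_chainProd_lapNNCore_dotProduct (d : ℕ) (σ μ : Fin d → Fin 2) :
    ![(1 : K), 0, 0, 1, 1] ᵥ* TensorTrain.chainProd (fun _ => lapNNCore K) d (fun r => (σ r, μ r)) ⬝ᵥ
        ![2, -1, -1, -1, -1] =
      laplaceNN K (2 ^ d) (quanticsEquiv 2 d σ) (quanticsEquiv 2 d μ) := by
  rw [← eval_lapNNTrain, lapNNTrain, TensorTrain.eval_uniform]

/-- THE MIDDLE SUPERCORE IDENTITY WITH `Δ_NN` (uniform form, every `d ≥ 0`):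
`E · diag(W,I₂,I₁,I)(i₁,j₁) ⋯ diag(W,I₂,I₁,I)(i_d,j_d) · B(c) = [𝟙[m=n] cΔ_NN^{(d)}(m,n); 0 𝟙[m=n]]`.
[cite: KazeevKhoromskij2012, Cor. 2.6] -/
theorem supBondL_mul_chainProd_mul_supBondR_nn (c : K) (d : ℕ) (σ μ : Fin d → Fin 2) :
    supBondL K ![(1 : K), 0, 0, 1, 1] *
        TensorTrain.chainProd (fun _ => supCore K (lapNNCore K)) d (fun r => (σ r, μ r)) *
        supBondR K c ![2, -1, -1, -1, -1] =
      laplaceMultiCore c (laplaceNN K (2 ^ d)) (quanticsEquiv 2 d σ, quanticsEquiv 2 d μ) :=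
  supBondL_mul_chainProd_mul_supBondR _ _ _ _ c σ μ (vecMul_chainProd_lapNNCore_zero d σ μ)
    (vecMul_chainProd_lapNNCore_dotProduct d σ μ)

/-- COROLLARY 2.6, MIDDLE SUPERCORE, VERBATIM (`d = k + 4 ≥ 4`): the `((i₁…i_d), (j₁…j_d))` block
entry of
`[I J' J I₂ 0; 0 0 0 0 I] ⋈ [I J' J 0 I₁ 0; 0 J 0 0 0 0; 0 0 J' 0 0 0; 0 0 0 I₂ -I₁ 0; 0 0 0 0 0 I]
   ⋈ [I J' J 0 0 0; 0 J 0 0 0 0; 0 0 J' 0 0 0; 0 0 0 I₂ 0 0; 0 0 0 0 I₁ 0; 0 0 0 0 0 I]^{⋈(d-4)}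
   ⋈ [I J' J 0 0; 0 J 0 0 0; 0 0 J' 0 0; 0 0 0 aI₂ 0; 0 0 0 0 aI₁; 0 0 0 -I -I]
   ⋈ [I a(2I-J-J'); 0 -aJ; 0 -aJ'; 0 -I₂; 0 -I₁]`,
i.e. `dnSupFirst(i₁,j₁) · nnSupSecond(i₂,j₂) · diag(W,I₂,I₁,I)(i₃,j₃) ⋯ (i_{d-2},j_{d-2}) ·
nnSupPenult a (i_{d-1},j_{d-1}) · nnSupLast a (i_d,j_d)`, is `[𝟙[m=n] aΔ_NN^{(d)}(m,n); 0 𝟙[m=n]]` — the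
block entry of `[I^{⊗d} a_kΔ_NN^{(d)}; 0 I^{⊗d}]`, a rank-`5, 6 ⋯ 6, 5` QTT representation.
[cite: KazeevKhoromskij2012, Cor. 2.6] -/
theorem dnSupFirst_mul_nnSupSecond_mul_chainProd_mul_nnSupPenult_mul_nnSupLast (c : K) (k : ℕ)
    (σ μ : Fin (k + 4) → Fin 2) :
    dnSupFirst K (σ 0, μ 0) * nnSupSecond K (σ 1, μ 1) *
        TensorTrain.chainProd (fun _ => supCore K (lapNNCore K)) k
          (fun r : Fin k => (σ r.succ.succ.castSucc.castSucc, μ r.succ.succ.castSucc.castSucc)) *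
        nnSupPenult K c (σ (Fin.last (k + 2)).castSucc, μ (Fin.last (k + 2)).castSucc) *
        nnSupLast K c (σ (Fin.last (k + 3)), μ (Fin.last (k + 3))) =
      laplaceMultiCore c (laplaceNN K (2 ^ (k + 4)))
        (quanticsEquiv 2 (k + 4) σ, quanticsEquiv 2 (k + 4) μ) := by
  have hchain : supCore K (lapNNCore K) (σ 0, μ 0) *
        (supCore K (lapNNCore K) (σ 1, μ 1) *
          TensorTrain.chainProd (fun _ => supCore K (lapNNCore K)) k
            (fun r : Fin k =>
              (σ r.succ.succ.castSucc.castSucc, μ r.succ.succ.castSucc.castSucc))) *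
        supCore K (lapNNCore K) (σ (Fin.last (k + 2)).castSucc, μ (Fin.last (k + 2)).castSucc) *
        supCore K (lapNNCore K) (σ (Fin.last (k + 3)), μ (Fin.last (k + 3))) =
      TensorTrain.chainProd (fun _ => supCore K (lapNNCore K)) (k + 4) (fun r => (σ r, μ r)) := by
    rw [TensorTrain.chainProd, TensorTrain.chainProd, TensorTrain.chainProd_succ_eq_mul,
      TensorTrain.chainProd_succ_eq_mul]
    rfl
  rw [nnSupSecond_eq, ← Matrix.mul_assoc (dnSupFirst K _), dnSupFirst_mul_nnSupM,
    ← supBondL_mul_chainProd_mul_supBondR_nn c (k + 4) σ μ, ← hchain, nnSupPenult_eq]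
  simp only [Matrix.mul_assoc]
  rw [nnSupY_mul_nnSupLast]

/-- [folklore] `[I J' J I₂ I₁] = (1,0,0,1,1) ⋈ diag(W, I₂, I₁)` as a row matrix (bookkeeping). -/
private theorem nnFirst_eq_of (p : Fin 2 × Fin 2) :
    nnFirst K p = Matrix.of fun (_ : Fin 1) j => (![(1 : K), 0, 0, 1, 1] ᵥ* lapNNCore K p) j := by
  ext i j
  fin_cases i; fin_cases j <;>
    simp [nnFirst, lapNNCore, Matrix.vecMul, dotProduct, Fin.sum_univ_five]

/-- COROLLARY 2.6, FIRST SUPERCORE, VERBATIM (`d = k + 3 ≥ 3`): the block entry of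
`[I J' J I₂] ⋈ [I J' J 0 I₁; 0 J 0 0 0; 0 0 J' 0 0; 0 0 0 I₂ -I₁]
   ⋈ [I J' J 0 0; 0 J 0 0 0; 0 0 J' 0 0; 0 0 0 I₂ 0; 0 0 0 0 I₁]^{⋈(d-3)} ⋈ [I a(2I-J-J'); 0 -aJ; 0 -aJ'; 0 -aI₂; 0 -aI₁]`
(the first two cores are the reduced head of Lem. 2.2) is `[𝟙[m=n] aΔ_NN^{(d)}(m,n)]`, the block
entry of the first supercore `[I^{⊗d} a₁Δ_NN^{(d)}]` — a rank-`4, 5 ⋯ 5` QTT representation.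
[cite: KazeevKhoromskij2012, Cor. 2.6] -/
theorem dnFirst_mul_nnSecond_mul_chainProd_mul_nnSupLast₁ (c : K) (k : ℕ) (σ μ : Fin (k + 3) → Fin 2) :
    dnFirst K (σ 0, μ 0) * nnSecond K (σ 1, μ 1) *
        TensorTrain.chainProd (fun _ => lapNNCore K) k
          (fun r : Fin k => (σ r.succ.succ.castSucc, μ r.succ.succ.castSucc)) *
        nnSupLast₁ K c (σ (Fin.last (k + 2)), μ (Fin.last (k + 2))) =
      !![(1 : Matrix (Fin (2 ^ (k + 3))) (Fin (2 ^ (k + 3))) K)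
          (quanticsEquiv 2 (k + 3) σ) (quanticsEquiv 2 (k + 3) μ),
        c * laplaceNN K (2 ^ (k + 3)) (quanticsEquiv 2 (k + 3) σ) (quanticsEquiv 2 (k + 3) μ)] := by
  have key : (![(1 : K), 0, 0, 1, 1] ᵥ*
        TensorTrain.chainProd (fun _ => lapNNCore K) (k + 3) (fun r => (σ r, μ r))) ᵥ*
        supBondR₁ K c ![(2 : K), -1, -1, -1, -1] =
      (((![(1 : K), 0, 0, 1, 1] ᵥ* lapNNCore K (σ 0, μ 0)) ᵥ* lapNNCore K (σ 1, μ 1)) ᵥ*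
        TensorTrain.chainProd (fun _ => lapNNCore K) k
          (fun r : Fin k => (σ r.succ.succ.castSucc, μ r.succ.succ.castSucc))) ᵥ*
        (lapNNCore K (σ (Fin.last (k + 2)), μ (Fin.last (k + 2))) *
          supBondR₁ K c ![(2 : K), -1, -1, -1, -1]) := by
    rw [TensorTrain.chainProd, TensorTrain.chainProd_succ_eq_mul, TensorTrain.chainProd_succ_eq_mul]
    simp only [Matrix.vecMul_vecMul, Matrix.mul_assoc]
    rfl
  ext i j
  fin_cases i
  rw [nnSecond_eq, ← Matrix.mul_assoc (dnFirst K _), dnFirst_mul_nnL, nnFirst_eq_of, nnSupLast₁_eq,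
    of_row_mul, of_row_mul, of_row_mul, Matrix.of_apply, ← key,
    vecMul_chainProd_vecMul_supBondR₁ (lapNNCore K) _ _ (laplaceNN K (2 ^ (k + 3))) c σ μ
      (vecMul_chainProd_lapNNCore_zero (k + 3) σ μ)
      (vecMul_chainProd_lapNNCore_dotProduct (k + 3) σ μ)]
  fin_cases j <;> simp

/-- COROLLARY 2.6, LAST SUPERCORE BEFORE REDUCTION (`d = k + 3 ≥ 3`; not displayed in the paper,
the analogue of the first equality in the proof of Cor. 2.5): the block entry of
`[I J' J I₂ 0; 0 0 0 0 I] ⋈ nnSupSecond ⋈ diag(W,I₂,I₁,I)^{⋈(d-3)} ⋈ [a(2I-J-J'); -aJ; -aJ'; -aI₂; -aI₁; I]`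
is the column `[aΔ_NN^{(d)}(m,n); 𝟙[m=n]]`.  [cite: KazeevKhoromskij2012, Cor. 2.6] -/
theorem dnSupFirst_mul_nnSupSecond_mul_chainProd_mul_nnSupLastCol (c : K) (k : ℕ)
    (σ μ : Fin (k + 3) → Fin 2) :
    dnSupFirst K (σ 0, μ 0) * nnSupSecond K (σ 1, μ 1) *
        TensorTrain.chainProd (fun _ => supCore K (lapNNCore K)) k
          (fun r : Fin k => (σ r.succ.succ.castSucc, μ r.succ.succ.castSucc)) *
        nnSupLastCol K c (σ (Fin.last (k + 2)), μ (Fin.last (k + 2))) =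
      !![c * laplaceNN K (2 ^ (k + 3)) (quanticsEquiv 2 (k + 3) σ) (quanticsEquiv 2 (k + 3) μ);
        (1 : Matrix (Fin (2 ^ (k + 3))) (Fin (2 ^ (k + 3))) K)
          (quanticsEquiv 2 (k + 3) σ) (quanticsEquiv 2 (k + 3) μ)] := by
  have hchain : supCore K (lapNNCore K) (σ 0, μ 0) *
        (supCore K (lapNNCore K) (σ 1, μ 1) *
          TensorTrain.chainProd (fun _ => supCore K (lapNNCore K)) k
            (fun r : Fin k => (σ r.succ.succ.castSucc, μ r.succ.succ.castSucc))) *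
        supCore K (lapNNCore K) (σ (Fin.last (k + 2)), μ (Fin.last (k + 2))) =
      TensorTrain.chainProd (fun _ => supCore K (lapNNCore K)) (k + 3) (fun r => (σ r, μ r)) := by
    rw [TensorTrain.chainProd, TensorTrain.chainProd_succ_eq_mul, TensorTrain.chainProd_succ_eq_mul]
    rfl
  rw [nnSupSecond_eq, ← Matrix.mul_assoc (dnSupFirst K _), dnSupFirst_mul_nnSupM,
    ← supBondL_mul_chainProd_mul_col (lapNNCore K) _ _ (laplaceNN K (2 ^ (k + 3))) c σ μ
      (vecMul_chainProd_lapNNCore_zero (k + 3) σ μ) (vecMul_chainProd_lapNNCore_dotProduct (k + 3) σ μ),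
    ← hchain, nnSupLastCol_eq]
  simp only [Matrix.mul_assoc, mul_of_col]

/-- COROLLARY 2.3 WITH THE SUPERCORES OF COR. 2.6 SUBSTITUTED (Rem. 1.2): for `d ≥ 1` the assembled
`Δ_NN` train evaluates, at the bit-pair string `(τ_ℓ, τ'_ℓ)`, to the entry of
`Σ_k I ⊗ ⋯ ⊗ a_kΔ_NN^{(d)} ⊗ ⋯ ⊗ I` at the serialised multi-indices.
[cite: KazeevKhoromskij2012, Cor. 2.6] -/
theorem eval_lapMultiNNTrain (a : ℕ → K) (D d : ℕ) (hd : 0 < d) (τ τ' : Fin (D * d) → Fin 2) :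
    (lapMultiNNTrain K a D d).eval (fun ℓ => (τ ℓ, τ' ℓ)) =
      laplaceMulti (fun k : Fin D => a k) (fun _ => laplaceNN K (2 ^ d)) (serialEquiv 2 D d τ)
        (serialEquiv 2 D d τ') :=
  eval_supTrain (lapNNCore K) _ _ a D d hd (laplaceNN K (2 ^ d)) (vecMul_chainProd_lapNNCore_zero d)
    (vecMul_chainProd_lapNNCore_dotProduct d) τ τ'

/-- THE QTT DECOMPOSITION OF THE `D`-DIMENSIONAL NEUMANN LAPLACE OPERATOR (Cor. 2.3 + Cor. 2.6,
uniform grids `2^d × ⋯ × 2^d`): the TT matrix of the assembled train is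
`Σ_k I ⊗ ⋯ ⊗ a_kΔ_NN^{(2^d)} ⊗ ⋯ ⊗ I` with its multi-indices serialised dimension by dimension.
[cite: KazeevKhoromskij2012, Cor. 2.6] -/
theorem ttMatrix_lapMultiNNTrain (a : ℕ → K) (D d : ℕ) (hd : 0 < d) :
    (lapMultiNNTrain K a D d).ttMatrix =
      (laplaceMulti (fun k : Fin D => a k) (fun _ => laplaceNN K (2 ^ d))).submatrix
        (serialEquiv 2 D d) (serialEquiv 2 D d) :=
  ttMatrix_supTrain (lapNNCore K) _ _ a D d hd (laplaceNN K (2 ^ d))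
    (vecMul_chainProd_lapNNCore_zero d) (vecMul_chainProd_lapNNCore_dotProduct d)

end NeumannNeumann

section NeumannNeumannReduced

variable (K : Type u) [Field K]

/-- The bond matrix `Z'(c) = [c 0 0 0; 0 c 0 0; 0 0 c 0; 0 0 0 c; -½c ½c ½c -c; ½ -½ -½ 0]` (`6 × 4`)
of the terminal rank reduction of the last supercore with `Δ_NN` (`Z(c)` of Cor. 2.5 with the row
`c·(-½, ½, ½, -1)` of `N` (Lem. 2.2) inserted for the `I₁` channel): `penultimate core =
diag(W, I₂, I₁, I) ⋈ Z'(c)` (uniform-form device; requires `½ ∈ K`).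
[cite: KazeevKhoromskij2012, Cor. 2.6] -/
def nnSupZ (c : K) : Matrix (Fin 6) (Fin 4) K :=
  !![c, 0, 0, 0; 0, c, 0, 0; 0, 0, c, 0; 0, 0, 0, c; -(2⁻¹ * c), 2⁻¹ * c, 2⁻¹ * c, -c;
    2⁻¹, -2⁻¹, -2⁻¹, 0]

/-- THE PENULTIMATE QTT CORE
`[aI aJ' aJ 0; 0 aJ 0 0; 0 0 aJ' 0; 0 0 0 aI₂; -½aI₁ ½aI₁ ½aI₁ -aI₁; ½I -½I -½I 0]` (`6 × 4`) of the
reduced last supercore `[a_DΔ_NN^{(d)}; I^{⊗d}]` of Cor. 2.6 (third display).  READING NOTE: the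
preprint prints the fifth row as `½aI₁ -½aI₁ -½aI₁ -aI₁`; the identity forces the signs
`-½aI₁ ½aI₁ ½aI₁ -aI₁` (`= aI₁ ⊗` the last row `(-½, ½, ½, -1)` of `N` of Lem. 2.2), which is what we
formalise: this row must sweep the last core `(2I-J-J', -J, -J', -I₂)ᵀ` into `-aI₁` (completing the
`I₁`-channel term `-aI₁^{⊗d}`), whereas the printed signs give `+aI₁ ⊗ (I + I₂)`.
[cite: KazeevKhoromskij2012, Cor. 2.6] -/
def nnSupPenultLast (c : K) (p : Fin 2 × Fin 2) : Matrix (Fin 6) (Fin 4) K :=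
  !![c * blkI K p, c * blkJ' K p, c * blkJ K p, 0; 0, c * blkJ K p, 0, 0; 0, 0, c * blkJ' K p, 0;
    0, 0, 0, c * blkI₂ K p;
    -(2⁻¹ * c) * blkI₁ K p, 2⁻¹ * c * blkI₁ K p, 2⁻¹ * c * blkI₁ K p, -c * blkI₁ K p;
    2⁻¹ * blkI K p, -2⁻¹ * blkI K p, -2⁻¹ * blkI K p, 0]

variable {K}

/-- `nnSupPenultLast a = diag(W, I₂, I₁, I) ⋈ Z'(a)` (bookkeeping).  [cite: KazeevKhoromskij2012, Cor. 2.6] -/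
theorem nnSupPenultLast_eq (c : K) (p : Fin 2 × Fin 2) :
    nnSupPenultLast K c p = supCore K (lapNNCore K) p * nnSupZ K c := by
  rw [supCore_lapNNCore]
  ext i j
  fin_cases i <;> fin_cases j <;>
    simp [nnSupPenultLast, nnSupZ, Matrix.mul_apply, Fin.sum_univ_six, mul_comm]

/-- THE SWEEP OF COR. 2.6's THIRD DISPLAY (where `½` enters): for every digit pair,
`Z'(c) · (diag(W,I₂) ⋈ (2,-1,-1,-1)ᵀ) = diag(W,I₂,I₁,I) · (B(c) ⋈ (0,1)ᵀ)`, i.e.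
`Z'(c)·[2I-J-J'; -J; -J'; -I₂] = [c(2I-J-J'); -cJ; -cJ'; -cI₂; -cI₁; I]`; the fifth row is
`-½c(2I-J-J') - ½cJ - ½cJ' + cI₂ = -c(I - I₂) = -cI₁` and the sixth `½(2I-J-J') + ½J + ½J' = I`.
Requires `2 ≠ 0` in `K`.  [cite: KazeevKhoromskij2012, Cor. 2.6] -/
theorem nnSupZ_mulVec_lapDNCore_mulVec [NeZero (2 : K)] (c : K) (p : Fin 2 × Fin 2) :
    nnSupZ K c *ᵥ (lapDNCore K p *ᵥ ![2, -1, -1, -1]) =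
      supCore K (lapNNCore K) p *ᵥ (supBondR K c ![(2 : K), -1, -1, -1, -1] *ᵥ ![(0 : K), 1]) := by
  have h2 : (2 : K)⁻¹ * 2 = 1 := inv_mul_cancel₀ two_ne_zero
  have h2c : (2 : K)⁻¹ * c * 2 = c := by rw [mul_assoc, mul_comm c, ← mul_assoc, h2, one_mul]
  rw [supCore_lapNNCore, supBondR_nn]
  obtain ⟨a, a'⟩ := p
  ext j
  fin_cases a <;> fin_cases a' <;> fin_cases j <;>
    simp [nnSupZ, lapDNCore, blkI, blkJ, blkJ', blkI₁, blkI₂, Matrix.mulVec, dotProduct,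
      Fin.sum_univ_two, Fin.sum_univ_four, Fin.sum_univ_six, h2, h2c] <;> ring

/-- COROLLARY 2.6, LAST SUPERCORE, VERBATIM up to the sign reading note at `nnSupPenultLast`
(`d = k + 4 ≥ 4`, `2 ≠ 0` in `K`): the block entry of
`[I J' J I₂ 0; 0 0 0 0 I] ⋈ [I J' J 0 I₁ 0; 0 J 0 0 0 0; 0 0 J' 0 0 0; 0 0 0 I₂ -I₁ 0; 0 0 0 0 0 I]
   ⋈ [I J' J 0 0 0; 0 J 0 0 0 0; 0 0 J' 0 0 0; 0 0 0 I₂ 0 0; 0 0 0 0 I₁ 0; 0 0 0 0 0 I]^{⋈(d-4)}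
   ⋈ [aI aJ' aJ 0; 0 aJ 0 0; 0 0 aJ' 0; 0 0 0 aI₂; -½aI₁ ½aI₁ ½aI₁ -aI₁; ½I -½I -½I 0]
   ⋈ [2I-J-J'; -J; -J'; -I₂]`
is `[aΔ_NN^{(d)}(m,n); 𝟙[m=n]]`, the block entry of the last supercore `[a_DΔ_NN^{(d)}; I^{⊗d}]` — a
rank-`5, 6 ⋯ 6, 4` QTT representation.  [cite: KazeevKhoromskij2012, Cor. 2.6] -/
theorem dnSupFirst_mul_nnSupSecond_mul_chainProd_mul_nnSupPenultLast_mul_dnLast [NeZero (2 : K)]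
    (c : K) (k : ℕ) (σ μ : Fin (k + 4) → Fin 2) :
    dnSupFirst K (σ 0, μ 0) * nnSupSecond K (σ 1, μ 1) *
        TensorTrain.chainProd (fun _ => supCore K (lapNNCore K)) k
          (fun r : Fin k => (σ r.succ.succ.castSucc.castSucc, μ r.succ.succ.castSucc.castSucc)) *
        nnSupPenultLast K c (σ (Fin.last (k + 2)).castSucc, μ (Fin.last (k + 2)).castSucc) *
        dnLast K (σ (Fin.last (k + 3)), μ (Fin.last (k + 3))) =
      !![c * laplaceNN K (2 ^ (k + 4)) (quanticsEquiv 2 (k + 4) σ) (quanticsEquiv 2 (k + 4) μ);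
        (1 : Matrix (Fin (2 ^ (k + 4))) (Fin (2 ^ (k + 4))) K)
          (quanticsEquiv 2 (k + 4) σ) (quanticsEquiv 2 (k + 4) μ)] := by
  have hchain : supCore K (lapNNCore K) (σ 0, μ 0) *
        (supCore K (lapNNCore K) (σ 1, μ 1) *
          TensorTrain.chainProd (fun _ => supCore K (lapNNCore K)) k
            (fun r : Fin k =>
              (σ r.succ.succ.castSucc.castSucc, μ r.succ.succ.castSucc.castSucc))) *
        supCore K (lapNNCore K) (σ (Fin.last (k + 2)).castSucc, μ (Fin.last (k + 2)).castSucc) *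
        supCore K (lapNNCore K) (σ (Fin.last (k + 3)), μ (Fin.last (k + 3))) =
      TensorTrain.chainProd (fun _ => supCore K (lapNNCore K)) (k + 4) (fun r => (σ r, μ r)) := by
    rw [TensorTrain.chainProd, TensorTrain.chainProd, TensorTrain.chainProd_succ_eq_mul,
      TensorTrain.chainProd_succ_eq_mul]
    rfl
  rw [nnSupSecond_eq, ← Matrix.mul_assoc (dnSupFirst K _), dnSupFirst_mul_nnSupM,
    ← supBondL_mul_chainProd_mul_col (lapNNCore K) _ _ (laplaceNN K (2 ^ (k + 4))) c σ μ
      (vecMul_chainProd_lapNNCore_zero (k + 4) σ μ) (vecMul_chainProd_lapNNCore_dotProduct (k + 4) σ μ),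
    ← hchain, nnSupPenultLast_eq, dnLast_eq_of]
  simp only [Matrix.mul_assoc, mul_of_col, nnSupZ_mulVec_lapDNCore_mulVec]

end NeumannNeumannReduced

section NeumannNeumannRanks

variable {K : Type u} [Field K]

/-- THEOREM 4.1 FOR `Δ_NN^{(d…d)}`, THE `6`s: every unfolding matrix of the assembled train has rank
`≤ 6` (line `4, 5…5, 2, 5, 6…6, 5, 2, …, 2, 5, 6…6, 4`).  [cite: KazeevKhoromskij2012, Thm. 4.1] -/
theorem rank_unfolding_lapMultiNNTrain_le (a : ℕ → K) (D d k m : ℕ) (h : k + m = D * d) :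
    (Matrix.of fun (s : Fin k → Fin 2 × Fin 2) (t : Fin m → Fin 2 × Fin 2) =>
        (lapMultiNNTrain K a D d).eval (fun i => Fin.append s t (i.cast h.symm))).rank ≤ 6 :=
  rank_unfolding_supTrain_le (lapNNCore K) _ _ a D d k m h

/-- THEOREM 4.1 FOR `Δ_NN^{(d…d)}`, THE `2`s: across the bond after the last site of each dimension
the unfolding rank is `≤ 2`.  [cite: KazeevKhoromskij2012, Thm. 4.1] -/
theorem rank_unfolding_lapMultiNNTrain_junction_le (a : ℕ → K) (D d ℓ m : ℕ) (hℓ : ℓ % d = d - 1)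
    (h : ℓ + 1 + m = D * d) :
    (Matrix.of fun (s : Fin (ℓ + 1) → Fin 2 × Fin 2) (t : Fin m → Fin 2 × Fin 2) =>
        (lapMultiNNTrain K a D d).eval (fun i => Fin.append s t (i.cast h.symm))).rank ≤ 2 :=
  rank_unfolding_supTrain_junction_le (lapNNCore K) _ _ a D d ℓ m hℓ h

/-- THEOREM 4.1 FOR `Δ_NN^{(d…d)}`, THE LEADING `5…5`: inside the first supercore (after `k < d`
sites) the unfolding rank is `≤ 5`.  [cite: KazeevKhoromskij2012, Thm. 4.1] -/
theorem rank_unfolding_lapMultiNNTrain_head_le (a : ℕ → K) (D d k m : ℕ) (hk : k < d)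
    (h : k + m = D * d) :
    (Matrix.of fun (s : Fin k → Fin 2 × Fin 2) (t : Fin m → Fin 2 × Fin 2) =>
        (lapMultiNNTrain K a D d).eval (fun i => Fin.append s t (i.cast h.symm))).rank ≤ 5 :=
  rank_unfolding_supTrain_head_le (lapNNCore K) _ _ a D d k m hk h

/-- [folklore] Row form of the head reduction of Lem. 2.2: `((1,0,0,1) · diag(W,I₂)(p)) · M =
(1,0,0,1,1) · diag(W,I₂,I₁)(p)` (bookkeeping case analysis, `I - I₂ = I₁`). -/
private theorem vecMul_lapDNCore_vecMul_nnL (p : Fin 2 × Fin 2) :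
    (![(1 : K), 0, 0, 1] ᵥ* lapDNCore K p) ᵥ* nnL K = ![(1 : K), 0, 0, 1, 1] ᵥ* lapNNCore K p := by
  obtain ⟨a, a'⟩ := p
  ext j
  fin_cases a <;> fin_cases a' <;> fin_cases j <;>
    simp [lapDNCore, nnL, lapNNCore, blkI, blkJ, blkJ', blkI₁, blkI₂, Matrix.vecMul, dotProduct,
      Fin.sum_univ_four, Fin.sum_univ_five]

/-- THEOREM 4.1 FOR `Δ_NN^{(d…d)}`, THE LEADING `4` (`d ≥ 2`): across the very first bond the
unfolding rank is `≤ 4` (the head reduction `[I J' J I₂] ⋈ M` of Lem. 2.2 / Cor. 2.6's second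
display).  [cite: KazeevKhoromskij2012, Thm. 4.1] -/
theorem rank_unfolding_lapMultiNNTrain_first_le (a : ℕ → K) (D d m : ℕ) (hd : 1 < d)
    (h : 1 + m = D * d) :
    (Matrix.of fun (s : Fin 1 → Fin 2 × Fin 2) (t : Fin m → Fin 2 × Fin 2) =>
        (lapMultiNNTrain K a D d).eval (fun i => Fin.append s t (i.cast h.symm))).rank ≤ 4 :=
  rank_unfolding_supTrain_first_le_of (lapNNCore K) _ _ a D d m hd h (nnL K * supEmbed K (n := 5))
    (fun p => ![(1 : K), 0, 0, 1] ᵥ* lapDNCore K p) fun p => by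
      rw [vecMul_supCore, Fin.init_snoc, Fin.snoc_last, zero_mul, ← Matrix.vecMul_vecMul,
        vecMul_lapDNCore_vecMul_nnL, vecMul_supEmbed]

/-- THEOREM 4.1 FOR `Δ_NN^{(d…d)}`, THE `5` OPENING EACH LATER SUPERCORE (`d ≥ 2`): across the bond
after the first site of every dimension `k ≥ 1` the unfolding rank is `≤ 5` (the head reduction
`[I J' J I₂ 0; 0 0 0 0 I] ⋈ diag(M, 1)` of Cor. 2.6).  [cite: KazeevKhoromskij2012, Thm. 4.1] -/
theorem rank_unfolding_lapMultiNNTrain_postJunction_le (a : ℕ → K) (D d ℓ m : ℕ) (hd : 1 < d)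
    (hℓ : ℓ % d = d - 1) (h : ℓ + 2 + m = D * d) :
    (Matrix.of fun (s : Fin (ℓ + 2) → Fin 2 × Fin 2) (t : Fin m → Fin 2 × Fin 2) =>
        (lapMultiNNTrain K a D d).eval (fun i => Fin.append s t (i.cast h.symm))).rank ≤ 5 :=
  rank_unfolding_supTrain_postJunction_le_of (lapNNCore K) _ _ a D d ℓ m hd hℓ h (nnSupM K)
    (fun p => dnSupFirst K p) fun p => (dnSupFirst_mul_nnSupM p).symm

/-- THEOREM 4.1 FOR `Δ_NN^{(d…d)}`, THE `5` CLOSING EACH MIDDLE SUPERCORE: across the bond before the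
last site of every dimension the unfolding rank is `≤ 5` (the tail reduction through `Y(a_k)`, the
`6 × 5` penultimate core of Cor. 2.6's first display).  [cite: KazeevKhoromskij2012, Thm. 4.1] -/
theorem rank_unfolding_lapMultiNNTrain_preJunction_le (a : ℕ → K) (D d ℓ m : ℕ)
    (hℓ : ℓ % d = d - 1) (h : ℓ + (m + 1) = D * d) :
    (Matrix.of fun (s : Fin ℓ → Fin 2 × Fin 2) (t : Fin (m + 1) → Fin 2 × Fin 2) =>
        (lapMultiNNTrain K a D d).eval (fun i => Fin.append s t (i.cast h.symm))).rank ≤ 5 :=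
  rank_unfolding_supTrain_preJunction_le_of (lapNNCore K) _ _ a D d ℓ m hℓ h (fun c => nnSupY K c)
    (fun c p => nnSupLast K c p) fun c p => (nnSupY_mul_nnSupLast c p).symm

/-- [folklore] The column entering the last site factors through `nnLastZ` (bookkeeping case
analysis, `I₁ = I - I₂`): `diag(W,I₂,I₁,I)(p) · (2c,-c,-c,-c,-c,1)ᵀ = nnLastZ(c) · (-cJ, -cJ', -cI₂, I)(p)`. -/
private theorem supCore_lapNNCore_mulVec (c : K) (p : Fin 2 × Fin 2) :
    supCore K (lapNNCore K) p *ᵥ (supBondR K c ![(2 : K), -1, -1, -1, -1] *ᵥ ![(0 : K), 1]) =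
      nnLastZ K c *ᵥ ![-c * blkJ K p, -c * blkJ' K p, -c * blkI₂ K p, blkI K p] := by
  rw [supCore_lapNNCore, supBondR_nn]
  obtain ⟨a, a'⟩ := p
  ext j
  fin_cases a <;> fin_cases a' <;> fin_cases j <;>
    simp [nnLastZ, blkI, blkJ, blkJ', blkI₁, blkI₂, Matrix.mulVec, dotProduct, Fin.sum_univ_two,
      Fin.sum_univ_four, Fin.sum_univ_six]

/-- THEOREM 4.1 FOR `Δ_NN^{(d…d)}`, THE TRAILING `4`: across the very last bond the unfolding rank is
`≤ 4` (the `6 × 4` penultimate core of Cor. 2.6's third display).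
[cite: KazeevKhoromskij2012, Thm. 4.1] -/
theorem rank_unfolding_lapMultiNNTrain_last_le (a : ℕ → K) (D d k : ℕ) (h : k + 1 = D * d) :
    (Matrix.of fun (s : Fin k → Fin 2 × Fin 2) (t : Fin 1 → Fin 2 × Fin 2) =>
        (lapMultiNNTrain K a D d).eval (fun i => Fin.append s t (i.cast h.symm))).rank ≤ 4 :=
  rank_unfolding_supTrain_last_le_of (lapNNCore K) _ _ a D d k h (fun c => nnLastZ K c)
    (fun c p => ![-c * blkJ K p, -c * blkJ' K p, -c * blkI₂ K p, blkI K p])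
    (supCore_lapNNCore_mulVec)

end NeumannNeumannRanks

end Literature.LinearAlgebra.TensorNetworks
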